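import Summits.AtomisticToContinuum.BoseEinsteinCondensation.Theses.BECInsertionCorrector
import Summits.AtomisticToContinuum.BoseEinsteinCondensation.Theses.BECBathMassLiouville
import Literature.MathematicalPhysics.QuantumManyBody.PeriodicBoseGasMomentumSector
import Literature.MathematicalPhysics.QuantumManyBody.PeriodicBoseGasLemma33
import Literature.MathematicalPhysics.QuantumManyBody.PeriodicBoseGasThm31
import Literature.MathematicalPhysics.QuantumManyBody.CoarseModeRayPOVMFormCore
import Literature.MathematicalPhysics.QuantumManyBody.CoarseModeRayPOVMOneParticle
import Literature.MeasureTheory.Lebesgue.SaturatedNonmeasurableSet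

/-!
# Disproof work file for crux `StaticResponseBound` (stmt-AtomisticToContinuum-12057)

Standing adversary file (cdisprove, generation 2, 2026-08-15).  Prose lives in docstrings only;
every `theorem` below is sorry-free (rc 0, axioms `propext/Classical.choice/Quot.sound`).

## Findings (index)

* §A `staticResponseBound_iff` (crux ↔ `∀ v, IRFR v → ∃ ρ₀>0 C>0, Body v ρ₀ C`, by `Iff.rfl`),
  `staticResponseBound_routes_agree` (both routes' decls coincide), `forall_quad_iff` /
  `forall_ineq_iff_discriminant` (the `∀ t` family ↔ the SUSCEPTIBILITY FORM
  `⟨∑ⱼcos(p·xⱼ)⟩_Ψ² ≤ 4CN(E_Ψ − E₀)/max(ρa,|p|²)` for every finite-energy `Ψ`),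
  `Body.mono_C` / `Body.mono_ρ₀`, `staticResponseBound_iff_large_C` (WLOG `C ≥ 1`).
* §B `not_staticResponseBoundAnyK` — **`k ≠ 0` is load-bearing** (`v = 0`, `N = 1`, `k = 0`).
* §T toolkit — `arg` (`θ_k = p·x`), `integral_cell_cos_arg` (`∫_cell cos θ_k = 0`, `k ≠ 0`),
  `integral_cell_trig_combo`, the modulated mode `phiMode = 1 + 2ε cos θ_k` with
  `∫φ² = (1+2ε²)L³`, `∫cos θ_k φ² = 2εL³`, `integral_cellN_two_mul` (Fubini on `cell²`).
* §E `not_staticResponseBoundWithoutFiniteEnergy` — **the guard `periodicEnergy v Ψ ≠ ⊤` is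
  load-bearing** (hard core, `N = 2`, `Ψ = φ_ε⊗φ_ε/‖·‖`: energy `⊤`, `toReal = 0`, modulation `> 0`).
* §C `max_le_of_body`, `le_C_of_body`, `half_le_C_of_body` — **TIGHTNESS: any admissible
  constant has `C ≥ 1/2`, for every `v`** (one-particle witness, exact kinetic energy
  `2ε²|p|²/(1+2ε²)` and modulation `2ε/(1+2ε²)`); `staticResponseBound_iff_half_le`;
  `not_body_of_lt_half` (refuted strengthening `C < 1/2`).
* §F `not_staticResponseBoundUniform_of_unbounded_scatteringLength` — the quantifier order
  `∃ ρ₀ C` AFTER `v` is forced, conditional on `a(v)` being unbounded over the admissible class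
  (hard spheres: `a = R`, a capacity computation not in the tree); `scatteringLength_le_of_body`.
* §G certified trivial regimes — `integral_norm_sq_eq_one`, `abs_cosMean_le` (`|⟨∑cos⟩| ≤ N`),
  `ineq_zero` (`t = 0`), `ineq_N_zero`, `ineq_of_large_t` (`|t| ≥ max(ρa,|p|²)/C`): the OPEN
  REMAINDER is the window `0 < |t| < max(ρa,|p|²)/C`, `N ≥ 1` (and `N = 1`/`v = 0` are settled by
  the free square, sibling evidence `srbAt_zero`).

Generation 1 of this seat (evidence `20260815T225726Z-Disproof.lean` on the item, 1715 lines,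
not readable from generation 2's jail, hence re-derived where cheap) additionally had: the
`N`-body periodic integration by parts `integral_cellN_fderiv_eq_zero`, the free completed square
`free_response_bound : ⟨H⟩_Ψ + t⟨∑cos⟩_Ψ ≥ −N t²/|p|²` (all `N`, all `v ≥ 0`), hence the crux's
large-`k`/large-`|t|` instances (`crux_instance_of_free_square`), and the hard-sphere version of
§F.  The sibling seat of crux 12058 attached `FreeStaticResponseCandidate.lean`
(`srbAt_zero`: the body VERBATIM at `v = 0` with `ρ₀ = 1`, `C = 1`).

## Why the crux resists (regime by regime; `χ_N(p) := sup_Ψ ⟨∑cos⟩²/(4(E_Ψ−E₀))`)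

The crux says `χ_N(p) ≤ CN/max(ρa,|p|²)` uniformly in `N ≥ 1`, `k ≠ 0`, at every `ρ < ρ₀(v)`.
* `N = 0`, `t = 0`: trivial (`E₀ ≤ E_Ψ`).  `N = 1`: free Laplacian whatever `v`; `χ = 1/(2|p|²)·N`
  so `C = 1/2` is NEEDED (§C) and `C = 1` suffices (free square).  `v = 0`, all `N`: same.
* few-body box `2 ≤ N ≲ (2π)³(ρa³)^{-1/2}` (`L ≲ ξ = (ρa)^{-1/2}`): `max = |p|²`, interaction
  shifts `O(a/L³) ≪ |p|² = O(L⁻²)`, response = free `+ O(a/L)`.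
* phonon branch `|p|² < ρa` (`N ≳ (ρa³)^{-1/2}`): LDA against `e(ρ) = 4πaρ²(1+O(√(ρa³)))` gives
  `E₀ − E₀(t) = t²N/(32πρa)` up to `|t| ≈ 8πρa`, then the trivial floor `−|t|N`; the statement is
  calibrated so that FULL density modulation (cost `≈ N·max(quantum pressure |p|², compressibility
  ρa)`) never sets in below `|t| ≈ max(ρa,|p|²)`, which is exactly where `Ct²N/max ≥ |t|N`.
  By convexity of `f(t) = E₀ − E₀(t)` nothing cheaper than such a premature saturation could
  violate the bound, and no mechanism for it exists in the dilute repulsive gas.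
* large `|p|` (impulse regime): `m₋₁ → N/(2|p|²)(1 + O(ρa³))`; a violation needs low-energy
  spectral weight `f` of `ρ_pΦ₀` with `f ≳ c/|p|` at energies `≈` yrast(`p`) `≥ c|p|` (phonons;
  vortex rings undercut phonons only for `|p| ≳ 40/a` and cost `≫ ρa`) — physically
  exponentially small.
* what a counterexample must be: a SOFT DENSITY MODE, `χ_N(p)·max(ρa,|p|²)/N → ∞` along some
  `(N,k)` at arbitrarily small `ρ` — anomalous compressibility (`e″ ≪ 8πa`, excluded on density
  scales `δρ/ρ ≳ Y^{1/34}` by the LY lower + LHY upper bounds and convexity) or incipient density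
  order in the dilute repulsive gas.  Unknown for any finite-range `v ≥ 0` at small `ρ`; at HIGH
  density it does happen (soft-core cluster crystals, hard-sphere solid; gen-1: roton softening of
  the penetrable sphere at `ρ_c ≈ 7.6/(aR₀²)`), which is why `ρ < ρ₀` is load-bearing physically
  (not formalisable today: for hard cores the high-density body is even VACUOUSLY true, all
  two-body states having energy `⊤` once `√3L/2 < R₀`).
* in print: rigorous momentum-dependent susceptibility UPPER bounds are the acknowledged open part
  of the Pitaevskii–Stringari programme (Momoi 1996 §1, quoted in barrier
  `PitaevskiiStringariOneDimension`, scope_caveats (e)); the Bogoliubov shape `1/(p²+16πρa)` is a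
  theorem only in Gross–Pitaevskii scaling (Boccato–Brennecke–Cenatiempo–Schlein 2019).  Nothing
  refutes the crux; nothing proves it.  Negatives index / `Theorems/*Refutation.lean` of this
  sub-problem (BECSwapAffinitySwapJensen, BECPopovBerryRGBerryStiffPhaseLRO): unrelated.

## Learnings for the provers and the lead

1. (§E) The guard is essential, not decoration: every energy identity must be run on
   finite-energy states; `toReal` of `⊤` is `0`.
2. (§C) Any proof must output `C ≥ 1/2`; Bogoliubov suggests `1/2 + O(√(ρa³))` suffices for the
   `t → 0` content, but `S(p) > 1` by a hair near `pa ≈ 5` (card stable-fraction…, NOTES) and the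
   non-perturbative `t`-window push the sharp constant slightly above `1/2`: aim for `C = 1` or
   larger (it is existential), never for `1/2`.
3. (§A) `k ≠ 0` cancels the first order ONLY for translation-invariant states.  For general `Ψ`
   the linear term `t⟨∑cos⟩_Ψ` is there and is absorbed by `E_Ψ − E₀` through the discriminant: the
   crux IS an energy-controlled bound on density modulations of ARBITRARY excited states,
   `⟨∑cos⟩_Ψ² ≤ 4CN(E_Ψ−E₀)/max`, not only ground-state linear response.
4. On line `stable-fraction-square-completion` (`StableFractionSquareSketch.lean`): its (S1)
   `SingleModeAttractionStability` at fixed `θ` is NOT weaker than the crux's small-`t` content.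
   Testing (S1) on `Φ_t` = ground state of `H + t∑cos` (so `⟨ρ_p⟩ = −t m`, `m = m₋₁(ρ_p)`,
   `E_{Φ_t} − E₀ = t²m/2`) gives `t²(m/2)(1 − 2λm) + O(t³) ≥ −D(ρa+p²) − λ·O(t)` with
   `λ = θg_pρ/N`; if `2λm > 1` the gain grows until saturation `t ≈ N/m`, i.e. becomes EXTENSIVE
   `≈ Nρa(2λm−1)`.  Hence (S1) ⟹ `m₋₁^exact(ρ_p) ≤ θ⁻¹ N|p|²/e_p² = θ⁻¹ m₋₁^Bog(ρ_p)` at EVERY `p`: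
   (S1) = [the crux's `t → 0` content with the sharp Bogoliubov constant divided by `θ`] +
   nonlinear stability.  So `θ ≤ inf_p m₋₁^Bog/m₋₁^exact`, which is `< 1` by a hair near `pa ≈ 5`;
   `θ = 1/2` is consistent, `θ → 1` is not available, and (S1) inherits the full difficulty of the
   crux at `t → 0` (it removes the `∀ t` but not the uniformity in `(N, k)`).  Free-gas sanity
   check: `H − θ(p²/2N)(|ρ_p|²−N)` is the quantum Hamiltonian-mean-field rotor model, mean-field
   threshold `θ_c = 1` exactly (free-rotor polarisability `χ₀ = 1`), as the card predicts.
5. `WindowReduction` (same sketch) — algebra checked: sharp ECSF for sector-pure states plus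
   `Δ_* := min_q max(Δ_q, Δ_{q+p})` give `⟨∑cos⟩² ≤ 2(L³/θg_p)(1 + D̃/Δ_*)(E−E₀)`; the sectors `q = 0`,
   `q = −p` are covered because `max(Δ₀, Δ_{±p}) = Δ_p`; Galilean-boost sectors `q = N·2πk′/L`
   have `Δ_q = 4π²N|k′|²/L²` exactly (covariance `U*HU = H + 2Q₀·P + N|Q₀|²`), consistent with
   `SectorFloor` for all `N ≥ 1` at small `ρ`.  No cheap kill; the inputs (T1)/(T2) are open.
6. The other cards' typed first lemmas (`SketchIdeator1.lean`: `sectorFloor_to_hMinusOne`,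
   `response_to_hyperuniformity`, `thomson_flow_reduction`, `logSobolev_to_response`) were checked
   on paper (Feynman `S ≤ p²/ω` + Cauchy–Schwarz; `F = 1 + εV` with `𝓔_Θ(V) = N|p|²/2` by
   translation invariance; `|p|V = −∇*Y − Q` with `‖∇*Y‖₋₁ ≤ ‖Y‖_{L²(Θ²)} = √(N/2)`; Otto–Villani
   `LSI ⇒ T₂` + Kantorovich with `Lip(V) = √N|p|` in the `ℓ²(ℝ^{3N})` metric of the Dirichlet
   form): all consistent conditional bricks; their hypotheses (sector floors, an LSI constant
   `κ ≈ c·2π/L`, an `H₋₁` bound on the force wave) carry the entire difficulty.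

* §H **two round-1 typed first lemmas are FALSE AS TYPED** (verbatim copies of
  `SketchIdeator3.lean`, which is not an importable module): `not_fibreSubadditivity` (card
  `fibre-centering-free-branch`, lemma `FibreSubadditivity`) and `not_screenedFluxBound` (card
  `feynman-defect-screened-flux`, lemma `ScreenedFluxBound`).  Mechanism: the charges `θᵢ`, `w`,
  `r` are arbitrary functions, and a charge `1_S` with `S` a SATURATED non-measurable set
  (`exists_isSaturated_config_one/two`, from the tree's Halmos §16 Thm. E) has ALL Bochner pairings
  `∫ 1_S φ F² = 0` (`integral_indicator_mul_eq_zero`: junk if non-integrable, genuinely `0` if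
  integrable), so `1_S` is a "weak corrector of `δ ≡ 0`" and satisfies every fibre bound with
  constant `0`, while `1_S + (h − 1_S) = h = cos θ_{e₀}(x₁)` has `‖h‖²₋₁ > 0`
  (`hMinusOneSqW_pos_of_sq_integral_pos`).  REPAIR (one line each): require the charges to be
  continuous (or periodic tests / in `L²(F²dX)`); the cards' intended instances are smooth, so the
  mechanisms are untouched — but a lead adopting these bricks as stubs must add the hypothesis.
  `ThomsonDual` and `RegressionSumRule` (same sketch) survive this attack (`g` enters both sides of
  `ThomsonDual` through the same pairings; `RegressionSumRule` is an identity between integrals of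
  continuous functions, checked by hand: `∫GD = (p|k|²/2)(∫F²∑sin²θⱼ − ∫F²G²)`).

## Targets
None registered yet (no skeleton / stubs on the item at generation 2); §H pre-empts two
candidate bricks.
-/

namespace Summit.AtomisticToContinuum.BoseEinsteinCondensation.Cruxes.StaticResponseBound.Disproof

open MeasureTheory
open scoped ENNReal
open Literature.MathematicalPhysics.QuantumManyBody.BoseGas
open Summit.AtomisticToContinuum.BoseEinsteinCondensation.Theses

noncomputable section

/-! ## §A  The crux unbundled: body, inner inequality, discriminant form -/

/-- `|p|² = (2π/L)² ∑ᵢ kᵢ²`, the crux's second `max` argument. -/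
def psq (L : ℝ) (k : Fin 3 → ℤ) : ℝ :=
  (2 * Real.pi / L) ^ 2 * ∑ i, (k i : ℝ) ^ 2

/-- `⟨∑ⱼ cos(p·xⱼ)⟩_Ψ = ∫_{cell^N} (∑ⱼ cos(2π k·xⱼ/L)) |Ψ|²` — verbatim the crux's integral. -/
def cosMean {N : ℕ} (L : ℝ) (k : Fin 3 → ℤ) (Ψ : PeriodicTrialState N L) : ℝ :=
  ∫ X in cellN N L, (∑ j, Real.cos (2 * Real.pi / L * ∑ i, (k i : ℝ) * X j i)) * ‖Ψ.ψ X‖ ^ 2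

/-- The crux's inner inequality at data `(v, C, ρ, N, k, t, Ψ)`. -/
def Ineq (v : ℝ → ℝ≥0∞) (C ρ : ℝ) (N : ℕ) (k : Fin 3 → ℤ) (t : ℝ)
    (Ψ : PeriodicTrialState N (sideLength ρ N)) : Prop :=
  (periodicGroundStateEnergy v N (sideLength ρ N)).toReal
      - C * t ^ 2 * N / max (ρ * (scatteringLength v).toReal) (psq (sideLength ρ N) k)
    ≤ (periodicEnergy v Ψ).toReal + t * cosMean (sideLength ρ N) k Ψ

/-- The crux's body at fixed potential and constants `(ρ₀, C)`. -/
def Body (v : ℝ → ℝ≥0∞) (ρ₀ C : ℝ) : Prop :=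
  ∀ ρ : ℝ, 0 < ρ → ρ < ρ₀ → ∀ N : ℕ, ∀ k : Fin 3 → ℤ, k ≠ 0 → ∀ t : ℝ,
    ∀ Ψ : PeriodicTrialState N (sideLength ρ N), periodicEnergy v Ψ ≠ ⊤ → Ineq v C ρ N k t Ψ

/-- The crux is literally `∀ v, IsRepulsiveFiniteRange v → ∃ ρ₀ > 0, ∃ C > 0, Body v ρ₀ C`. -/
theorem staticResponseBound_iff :
    BECInsertionCorrector.StaticResponseBound ↔
      ∀ v : ℝ → ℝ≥0∞, IsRepulsiveFiniteRange v → ∃ ρ₀ : ℝ, 0 < ρ₀ ∧ ∃ C : ℝ, 0 < C ∧ Body v ρ₀ C :=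
  Iff.rfl

/-- The two routes wanting the item (BECInsertionCorrector rank 2, BECBathMassLiouville rank 3)
state it verbatim identically: one refutation / proof serves both. -/
theorem staticResponseBound_routes_agree :
    BECInsertionCorrector.StaticResponseBound ↔ BECBathMassLiouville.StaticResponseBound :=
  Iff.rfl

/-- Elementary discriminant: `∀ t, A - B t² ≤ E + t X` iff `X² ≤ 4 B (E - A)` (for `B > 0`). -/
theorem forall_quad_iff {A E X B : ℝ} (hB : 0 < B) :
    (∀ t : ℝ, A - B * t ^ 2 ≤ E + t * X) ↔ X ^ 2 ≤ 4 * B * (E - A) := by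
  constructor
  · intro h
    set s := X / (2 * B) with hs
    have hX : X = 2 * B * s := by rw [hs]; field_simp
    have h1 := h (-s)
    rw [hX] at h1 ⊢
    nlinarith [h1, hB, sq_nonneg s]
  · intro h t
    nlinarith [sq_nonneg (2 * B * t + X), hB]

/-- With `B = 0` the family of inequalities degenerates to `X = 0 ∧ A ≤ E`. -/
theorem forall_quad_zero_iff {A E X : ℝ} :
    (∀ t : ℝ, A - 0 * t ^ 2 ≤ E + t * X) ↔ X = 0 ∧ A ≤ E := by
  constructor
  · intro h
    have h0 := h 0
    simp only [zero_mul, sub_zero, add_zero] at h0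
    refine ⟨?_, h0⟩
    by_contra hX
    rcases lt_or_gt_of_ne hX with hlt | hgt
    · have := h ((E - A + 1) / (-X))
      have hX' : 0 < -X := by linarith
      rw [zero_mul, sub_zero, div_mul_eq_mul_div, mul_comm, ← div_mul_eq_mul_div,
        div_neg, div_self hX, neg_mul, one_mul] at this
      · linarith
    · have := h (-((E - A + 1) / X))
      rw [zero_mul, sub_zero, neg_mul, div_mul_cancel₀ _ hgt.ne'] at this
      linarith
  · rintro ⟨rfl, hAE⟩ t
    simpa using hAE

/-- DISCRIMINANT (susceptibility) FORM of the inner inequality: for `N ≥ 1`, `C > 0` and a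
non-degenerate denominator, `(∀ t, Ineq)` says exactly
`⟨∑cos⟩_Ψ² ≤ 4 C N (E_Ψ - E₀) / max(ρa, p²)` — a bound `χ_N(p) ≤ 2CN/max(ρa,p²)` on the static
density response, to hold for EVERY finite-energy state, not only perturbatively. -/
theorem forall_ineq_iff_discriminant (v : ℝ → ℝ≥0∞) {C ρ : ℝ} {N : ℕ} (k : Fin 3 → ℤ)
    (Ψ : PeriodicTrialState N (sideLength ρ N)) (hC : 0 < C) (hN : 0 < N)
    (hmax : 0 < max (ρ * (scatteringLength v).toReal) (psq (sideLength ρ N) k)) :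
    (∀ t : ℝ, Ineq v C ρ N k t Ψ) ↔
      cosMean (sideLength ρ N) k Ψ ^ 2 ≤
        4 * (C * N / max (ρ * (scatteringLength v).toReal) (psq (sideLength ρ N) k)) *
          ((periodicEnergy v Ψ).toReal
            - (periodicGroundStateEnergy v N (sideLength ρ N)).toReal) := by
  have hB : 0 < C * N / max (ρ * (scatteringLength v).toReal) (psq (sideLength ρ N) k) := by
    have : (0 : ℝ) < N := by exact_mod_cast hN
    positivity
  rw [← forall_quad_iff hB]
  unfold Ineq
  constructor <;> intro h t <;> have := h t
  · calc _ = (periodicGroundStateEnergy v N (sideLength ρ N)).toReal - C * t ^ 2 * ↑N /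
          max (ρ * (scatteringLength v).toReal) (psq (sideLength ρ N) k) := by ring
      _ ≤ _ := this
  · calc _ = (periodicGroundStateEnergy v N (sideLength ρ N)).toReal -
          C * ↑N / max (ρ * (scatteringLength v).toReal) (psq (sideLength ρ N) k) * t ^ 2 := by ring
      _ ≤ _ := this

/-- Monotonicity in the constant: a larger `C` only weakens the body. -/
theorem Body.mono_C {v : ℝ → ℝ≥0∞} {ρ₀ C C' : ℝ} (h : Body v ρ₀ C) (hCC' : C ≤ C') :
    Body v ρ₀ C' := by
  intro ρ hρ hρ₀ N k hk t Ψ hΨ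
  have h1 := h ρ hρ hρ₀ N k hk t Ψ hΨ
  unfold Ineq at h1 ⊢
  have hmax : 0 ≤ max (ρ * (scatteringLength v).toReal) (psq (sideLength ρ N) k) :=
    le_max_of_le_right (by unfold psq; positivity)
  have : C * t ^ 2 * N / max (ρ * (scatteringLength v).toReal) (psq (sideLength ρ N) k) ≤
      C' * t ^ 2 * N / max (ρ * (scatteringLength v).toReal) (psq (sideLength ρ N) k) := by
    apply div_le_div_of_nonneg_right _ hmax
    have : (0 : ℝ) ≤ t ^ 2 * N := by positivity
    nlinarith
  linarith

/-- Monotonicity in the density threshold: a smaller `ρ₀` only weakens the body. -/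
theorem Body.mono_ρ₀ {v : ℝ → ℝ≥0∞} {ρ₀ ρ₀' C : ℝ} (h : Body v ρ₀ C) (hle : ρ₀' ≤ ρ₀) :
    Body v ρ₀' C :=
  fun ρ hρ hρ₀ => h ρ hρ (hρ₀.trans_le hle)

/-- Hence the crux may equivalently be asked with `C ≥ 1` (or any fixed floor) — only the
EXISTENCE of a finite constant matters, and §C below shows none below `1/2` can work. -/
theorem staticResponseBound_iff_large_C :
    BECInsertionCorrector.StaticResponseBound ↔
      ∀ v : ℝ → ℝ≥0∞, IsRepulsiveFiniteRange v → ∃ ρ₀ : ℝ, 0 < ρ₀ ∧ ∃ C : ℝ, 1 ≤ C ∧ Body v ρ₀ C := by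
  rw [staticResponseBound_iff]
  refine forall₂_congr fun v _ => ⟨?_, ?_⟩
  · rintro ⟨ρ₀, hρ₀, C, hC, hB⟩
    exact ⟨ρ₀, hρ₀, max C 1, le_max_right _ _, hB.mono_C (le_max_left _ _)⟩
  · rintro ⟨ρ₀, hρ₀, C, hC, hB⟩
    exact ⟨ρ₀, hρ₀, C, by linarith, hB⟩

/-! ## §B  The hypothesis `k ≠ 0` is load-bearing

Deleting `k ≠ 0` makes the statement false already for the free gas and one particle: at
`k = 0` the perturbation is the constant `N`, its first-order shift `tN` is not cancelled, and
the denominator `max(ρa, |p|²) = max(0, 0) = 0` is Lean-junk (`x / 0 = 0`). -/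

/-- The crux with the hypothesis `k ≠ 0` deleted (everything else verbatim). -/
def StaticResponseBoundAnyK : Prop :=
  ∀ v : ℝ → ℝ≥0∞, IsRepulsiveFiniteRange v → ∃ ρ₀ : ℝ, 0 < ρ₀ ∧ ∃ C : ℝ, 0 < C ∧
    ∀ ρ : ℝ, 0 < ρ → ρ < ρ₀ → ∀ N : ℕ, ∀ k : Fin 3 → ℤ, ∀ t : ℝ,
      ∀ Ψ : PeriodicTrialState N (sideLength ρ N), periodicEnergy v Ψ ≠ ⊤ → Ineq v C ρ N k t Ψ

/-- The free gas is an admissible interaction. -/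
theorem isRepulsiveFiniteRange_zero : IsRepulsiveFiniteRange (0 : ℝ → ℝ≥0∞) :=
  ⟨measurable_const, 0, fun _ _ => rfl⟩

/-- `L = (N/ρ)^{1/3} > 0` for `N ≥ 1`, `ρ > 0`. -/
theorem sideLength_pos {ρ : ℝ} (hρ : 0 < ρ) {N : ℕ} (hN : 0 < N) : 0 < sideLength ρ N := by
  unfold sideLength
  apply Real.rpow_pos_of_pos
  have : (0 : ℝ) < N := by exact_mod_cast hN
  positivity

/-- The constant one-particle state has zero energy, whatever `v`. -/
theorem periodicEnergy_const {L : ℝ} (hL : 0 < L) (v : ℝ → ℝ≥0∞) :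
    periodicEnergy v (PeriodicTrialState.const hL) = 0 := by
  refine (lintegral_congr fun X => ?_).trans lintegral_zero
  simp [PeriodicTrialState.const, kineticDensity, periodicInteraction]

/-- At `k = 0` the "density wave" is the particle number: `⟨∑ⱼ cos 0⟩ = N = 1`. -/
theorem cosMean_zero_const {L : ℝ} (hL : 0 < L) :
    cosMean L 0 (PeriodicTrialState.const hL) = 1 := by
  unfold cosMean
  have h3 : 0 < L ^ 3 := by positivity
  have hc : ∀ X : Config 1,
      (∑ j : Fin 1, Real.cos (2 * Real.pi / L * ∑ i : Fin 3, ((0 : Fin 3 → ℤ) i : ℝ) * X j i)) *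
        ‖(PeriodicTrialState.const hL).ψ X‖ ^ 2 = (L ^ 3)⁻¹ := by
    intro X
    simp [PeriodicTrialState.const, Real.sq_sqrt h3.le]
  simp_rw [hc]
  rw [setIntegral_const, measureReal_def, volume_cellN, pow_one, ← ENNReal.ofReal_pow hL.le,
    ENNReal.toReal_ofReal h3.le, smul_eq_mul, mul_inv_cancel₀ h3.ne']

/-- **`k ≠ 0` is load-bearing**: witness `v = 0`, `ρ = ρ₀/2`, `N = 1`, `k = 0`, `t = -1`,
`Ψ ≡ L^{-3/2}`; the inner inequality reads `0 - 0 ≤ 0 - 1`. Any proof of the crux must use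
`k ≠ 0` (it is what kills the first-order term `t⟨∑cos⟩ = tN·δ_{k,0}`). -/
theorem not_staticResponseBoundAnyK : ¬ StaticResponseBoundAnyK := by
  intro h
  obtain ⟨ρ₀, hρ₀, C, _hC, hB⟩ := h 0 isRepulsiveFiniteRange_zero
  have hρ : (0 : ℝ) < ρ₀ / 2 := by positivity
  have hL : 0 < sideLength (ρ₀ / 2) 1 := sideLength_pos hρ one_pos
  have key := hB (ρ₀ / 2) hρ (by linarith) 1 0 (-1) (PeriodicTrialState.const hL)
    (by rw [periodicEnergy_const]; exact ENNReal.zero_ne_top)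
  unfold Ineq at key
  rw [periodicGroundStateEnergy_one hL, periodicEnergy_const, cosMean_zero_const,
    scatteringLength_zero] at key
  norm_num [psq] at key

/-! ## §T  Toolkit: the phase `θ_k`, cosine integrals on the cell, the modulated mode `φ_ε` -/

/-- The crux's cosine argument `θ_k(x) = (2π/L) ∑ᵢ kᵢ xᵢ = p·x`. -/
def arg (L : ℝ) (k : Fin 3 → ℤ) (x : Space) : ℝ :=
  2 * Real.pi / L * ∑ i, (k i : ℝ) * x i

theorem arg_intSMul (L : ℝ) (m : ℤ) (k : Fin 3 → ℤ) (x : Space) :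
    arg L (m • k) x = m * arg L k x := by
  unfold arg
  simp only [Pi.smul_apply, smul_eq_mul, Int.cast_mul, Finset.mul_sum]
  refine Finset.sum_congr rfl fun i _ => ?_
  ring

/-- `Re e_k(x) = cos θ_k(x)`. -/
theorem re_cellWave (L : ℝ) (k : Fin 3 → ℤ) (x : Space) :
    (cellWave L k x).re = Real.cos (arg L k x) := by
  rw [cellWave_apply]
  have : (2 * Real.pi * Complex.I * (∑ i, (k i : ℝ) * x i : ℝ) / L : ℂ) =
      ((arg L k x : ℝ) : ℂ) * Complex.I := by
    unfold arg
    push_cast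
    ring
  push_cast at this ⊢
  rw [this, Complex.exp_ofReal_mul_I_re]

/-- `∫_{[0,L)³} cos θ_k = 0` for `k ≠ 0`. -/
theorem integral_cell_cos_arg {L : ℝ} (hL : 0 < L) {k : Fin 3 → ℤ} (hk : k ≠ 0) :
    ∫ x in cell L, Real.cos (arg L k x) = 0 := by
  have h := integral_cell_cellWave_eq_zero hL hk
  have hint : Integrable (cellWave L k) (volume.restrict (cell L)) :=
    integrableOn_cell (continuous_cellWave L k)
  have h2 := integral_re hint
  simp only [RCLike.re_to_complex, re_cellWave] at h2
  rw [h2, h, Complex.zero_re]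

/-- `∫_{[0,L)³} c = c L³`. -/
theorem integral_cell_const {L : ℝ} (hL : 0 < L) (c : ℝ) :
    ∫ _ in cell L, c = c * L ^ 3 := by
  rw [setIntegral_const, measureReal_def, volume_cell, ← ENNReal.ofReal_pow hL.le,
    ENNReal.toReal_ofReal (by positivity), smul_eq_mul, mul_comm]

/-- The modulated constant mode `φ_ε(x) = 1 + 2ε cos θ_k(x)` (real). -/
def phiMode (L : ℝ) (k : Fin 3 → ℤ) (ε : ℝ) (x : Space) : ℝ :=
  1 + 2 * ε * Real.cos (arg L k x)

@[fun_prop]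
theorem continuous_arg (L : ℝ) (k : Fin 3 → ℤ) : Continuous (arg L k) := by
  unfold arg; fun_prop

@[fun_prop]
theorem contDiff_arg (L : ℝ) (k : Fin 3 → ℤ) : ContDiff ℝ 1 (arg L k) := by
  unfold arg; fun_prop

@[fun_prop]
theorem continuous_phiMode (L : ℝ) (k : Fin 3 → ℤ) (ε : ℝ) : Continuous (phiMode L k ε) := by
  unfold phiMode; fun_prop

@[fun_prop]
theorem contDiff_phiMode (L : ℝ) (k : Fin 3 → ℤ) (ε : ℝ) : ContDiff ℝ 1 (phiMode L k ε) := by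
  unfold phiMode; fun_prop

/-- `θ_k(x + L e_a) = θ_k(x) + 2π k_a`. -/
theorem arg_add_single {L : ℝ} (hL : L ≠ 0) (k : Fin 3 → ℤ) (x : Space) (a : Fin 3) :
    arg L k (x + EuclideanSpace.single a L) = arg L k x + 2 * Real.pi * k a := by
  unfold arg
  simp only [PiLp.add_apply, PiLp.single_apply, mul_add, mul_ite, mul_zero,
    Finset.sum_add_distrib, Finset.sum_ite_eq', Finset.mem_univ, if_true]
  field_simp

/-- `φ_ε` is `Lℤ³`-periodic. -/
theorem phiMode_periodic {L : ℝ} (hL : L ≠ 0) (k : Fin 3 → ℤ) (ε : ℝ) (x : Space) (a : Fin 3) :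
    phiMode L k ε (x + EuclideanSpace.single a L) = phiMode L k ε x := by
  unfold phiMode
  rw [arg_add_single hL, show arg L k x + 2 * Real.pi * (k a : ℝ) =
    arg L k x + ((k a : ℤ) : ℝ) * (2 * Real.pi) by ring, Real.cos_add_int_mul_two_pi]

/-- `φ_ε ≥ 1 - 2|ε|`; in particular `φ_ε > 0` for `|ε| < 1/2`. -/
theorem phiMode_pos {L : ℝ} {k : Fin 3 → ℤ} {ε : ℝ} (hε : |ε| < 1 / 2) (x : Space) :
    0 < phiMode L k ε x := by
  unfold phiMode
  have h1 := Real.abs_cos_le_one (arg L k x)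
  have : |2 * ε * Real.cos (arg L k x)| ≤ 2 * |ε| := by
    rw [abs_mul, abs_mul, abs_two]
    nlinarith [abs_nonneg ε]
  have := neg_abs_le (2 * ε * Real.cos (arg L k x))
  linarith

/-- Pointwise trigonometry: `φ_ε² = (1 + 2ε²) + 4ε cos θ_k + 2ε² cos θ_{2k}`. -/
theorem phiMode_sq (L : ℝ) (k : Fin 3 → ℤ) (ε : ℝ) (x : Space) :
    phiMode L k ε x ^ 2 =
      (1 + 2 * ε ^ 2) + 4 * ε * Real.cos (arg L k x) + 2 * ε ^ 2 * Real.cos (arg L ((2 : ℤ) • k) x) := by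
  unfold phiMode
  rw [arg_intSMul, show ((2 : ℤ) : ℝ) * arg L k x = 2 * arg L k x by push_cast; ring, Real.cos_two_mul]
  ring

/-- Pointwise trigonometry: `cos θ_k · φ_ε² = 2ε + (1 + 3ε²) cos θ_k + 2ε cos θ_{2k} + ε² cos θ_{3k}`. -/
theorem cos_mul_phiMode_sq (L : ℝ) (k : Fin 3 → ℤ) (ε : ℝ) (x : Space) :
    Real.cos (arg L k x) * phiMode L k ε x ^ 2 =
      2 * ε + (1 + 3 * ε ^ 2) * Real.cos (arg L k x) + 2 * ε * Real.cos (arg L ((2 : ℤ) • k) x)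
        + ε ^ 2 * Real.cos (arg L ((3 : ℤ) • k) x) := by
  unfold phiMode
  rw [arg_intSMul, arg_intSMul,
    show ((2 : ℤ) : ℝ) * arg L k x = 2 * arg L k x by push_cast; ring,
    show ((3 : ℤ) : ℝ) * arg L k x = 3 * arg L k x by push_cast; ring,
    Real.cos_two_mul, Real.cos_three_mul]
  ring

/-- The cell has finite volume. -/
theorem isFiniteMeasure_restrict_cell (L : ℝ) : IsFiniteMeasure (volume.restrict (cell L)) := by
  refine ⟨?_⟩
  rw [Measure.restrict_apply_univ, volume_cell]
  exact ENNReal.pow_lt_top ENNReal.ofReal_lt_top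

/-- `∫_{[0,L)³} (a + b cos θ_k + c cos θ_{2k} + d cos θ_{3k}) = a L³` for `k ≠ 0`. -/
theorem integral_cell_trig_combo {L : ℝ} (hL : 0 < L) {k : Fin 3 → ℤ} (hk : k ≠ 0)
    (a b c d : ℝ) :
    ∫ x in cell L, (a + b * Real.cos (arg L k x) + c * Real.cos (arg L ((2 : ℤ) • k) x)
      + d * Real.cos (arg L ((3 : ℤ) • k) x)) = a * L ^ 3 := by
  haveI := isFiniteMeasure_restrict_cell L
  have h2k : (2 : ℤ) • k ≠ 0 := smul_ne_zero (by norm_num) hk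
  have h3k : (3 : ℤ) • k ≠ 0 := smul_ne_zero (by norm_num) hk
  have i0 : Integrable (fun _ : Space => a) (volume.restrict (cell L)) := integrable_const _
  have c1 : Integrable (fun x => Real.cos (arg L k x)) (volume.restrict (cell L)) :=
    integrableOn_cell (by fun_prop)
  have c2 : Integrable (fun x => Real.cos (arg L ((2 : ℤ) • k) x)) (volume.restrict (cell L)) :=
    integrableOn_cell (by fun_prop)
  have c3 : Integrable (fun x => Real.cos (arg L ((3 : ℤ) • k) x)) (volume.restrict (cell L)) :=
    integrableOn_cell (by fun_prop)
  have i1 : Integrable (fun x => b * Real.cos (arg L k x)) (volume.restrict (cell L)) :=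
    c1.const_mul b
  have i2 : Integrable (fun x => c * Real.cos (arg L ((2 : ℤ) • k) x)) (volume.restrict (cell L)) :=
    c2.const_mul c
  have i3 : Integrable (fun x => d * Real.cos (arg L ((3 : ℤ) • k) x)) (volume.restrict (cell L)) :=
    c3.const_mul d
  have i01 : Integrable (fun x => a + b * Real.cos (arg L k x)) (volume.restrict (cell L)) :=
    i0.add i1
  have i012 : Integrable (fun x => a + b * Real.cos (arg L k x) + c * Real.cos (arg L ((2 : ℤ) • k) x))
      (volume.restrict (cell L)) := i01.add i2
  rw [integral_add i012 i3, integral_add i01 i2, integral_add i0 i1]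
  simp only [integral_const_mul, integral_cell_cos_arg hL hk, integral_cell_cos_arg hL h2k,
    integral_cell_cos_arg hL h3k, integral_cell_const hL, mul_zero, add_zero]

/-- `∫_{[0,L)³} φ_ε² = (1 + 2ε²) L³`. -/
theorem integral_cell_phiMode_sq {L : ℝ} (hL : 0 < L) {k : Fin 3 → ℤ} (hk : k ≠ 0) (ε : ℝ) :
    ∫ x in cell L, phiMode L k ε x ^ 2 = (1 + 2 * ε ^ 2) * L ^ 3 := by
  have : (fun x => phiMode L k ε x ^ 2) = fun x => ((1 + 2 * ε ^ 2) + (4 * ε) * Real.cos (arg L k x)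
      + (2 * ε ^ 2) * Real.cos (arg L ((2 : ℤ) • k) x) + 0 * Real.cos (arg L ((3 : ℤ) • k) x)) := by
    funext x; rw [phiMode_sq]; ring
  rw [this, integral_cell_trig_combo hL hk]

/-- `∫_{[0,L)³} cos θ_k φ_ε² = 2ε L³` — the first-order density modulation of `φ_ε`. -/
theorem integral_cell_cos_mul_phiMode_sq {L : ℝ} (hL : 0 < L) {k : Fin 3 → ℤ} (hk : k ≠ 0) (ε : ℝ) :
    ∫ x in cell L, Real.cos (arg L k x) * phiMode L k ε x ^ 2 = 2 * ε * L ^ 3 := by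
  have : (fun x => Real.cos (arg L k x) * phiMode L k ε x ^ 2) = fun x => ((2 * ε)
      + (1 + 3 * ε ^ 2) * Real.cos (arg L k x) + (2 * ε) * Real.cos (arg L ((2 : ℤ) • k) x)
      + ε ^ 2 * Real.cos (arg L ((3 : ℤ) • k) x)) := by
    funext x; rw [cos_mul_phiMode_sq]
  rw [this, integral_cell_trig_combo hL hk]

/-- Fubini for a product of one-body factors on `cell²`. -/
theorem integral_cellN_two_mul {L : ℝ} (f g : Space → ℝ) :
    ∫ X in cellN 2 L, f (X 0) * g (X 1) = (∫ x in cell L, f x) * ∫ x in cell L, g x := by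
  rw [volume_restrict_cellN]
  have h := integral_fin_nat_prod_eq_prod (𝕜 := ℝ)
    (μ := fun _ : Fin 2 => (volume : Measure Space).restrict (cell L)) ![f, g]
  simp only [Fin.prod_univ_two, Matrix.cons_val_zero, Matrix.cons_val_one] at h
  exact h

/-- The unit lattice direction `e₀ = (1,0,0)`. -/
def e0 : Fin 3 → ℤ := Pi.single 0 1

theorem e0_ne_zero : e0 ≠ 0 := by
  intro h
  have := congr_fun h 0
  simp [e0] at this

theorem psq_e0 (L : ℝ) : psq L e0 = (2 * Real.pi / L) ^ 2 := by
  unfold psq e0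
  simp [Fin.sum_univ_three]

theorem psq_nonneg (L : ℝ) (k : Fin 3 → ℤ) : 0 ≤ psq L k := by
  unfold psq; positivity

theorem psq_e0_pos {L : ℝ} (hL : 0 < L) : 0 < psq L e0 := by
  rw [psq_e0]; positivity

/-! ## §E  The finite-energy guard `periodicEnergy v Ψ ≠ ⊤` is load-bearing

With a hard core, a smooth state overlapping the core has `periodicEnergy = ⊤`, whose `toReal`
is the junk value `0`; if such a state carries a density modulation `⟨∑cos⟩ ≠ 0`, the inner
inequality fails for small couplings `t` of the right sign — whatever the (unknown) value of
`E₀ ≥ 0`.  So the guard is not decoration: any proof must use it (it is what makes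
`(periodicEnergy v Ψ).toReal` the true energy). -/

/-- The crux with the guard `periodicEnergy v Ψ ≠ ⊤` deleted (everything else verbatim). -/
def StaticResponseBoundWithoutFiniteEnergy : Prop :=
  ∀ v : ℝ → ℝ≥0∞, IsRepulsiveFiniteRange v → ∃ ρ₀ : ℝ, 0 < ρ₀ ∧ ∃ C : ℝ, 0 < C ∧
    ∀ ρ : ℝ, 0 < ρ → ρ < ρ₀ → ∀ N : ℕ, ∀ k : Fin 3 → ℤ, k ≠ 0 → ∀ t : ℝ,
      ∀ Ψ : PeriodicTrialState N (sideLength ρ N), Ineq v C ρ N k t Ψ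

/-- The hard-sphere interaction of unit radius: `v(r) = ⊤` for `r ≤ 1`, `0` beyond. -/
def hardCore : ℝ → ℝ≥0∞ :=
  Set.indicator (Set.Iic 1) fun _ => ⊤

theorem isRepulsiveFiniteRange_hardCore : IsRepulsiveFiniteRange hardCore := by
  refine ⟨measurable_const.indicator measurableSet_Iic, 1, fun r hr => ?_⟩
  unfold hardCore
  rw [Set.indicator_of_notMem]
  simpa using hr

theorem hardCore_of_le_one {r : ℝ} (hr : r ≤ 1) : hardCore r = ⊤ := by
  unfold hardCore
  rw [Set.indicator_of_mem (Set.mem_Iic.mpr hr)]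

/-- The two-body product amplitude `Φ_ε(x₁,x₂) = φ_ε(x₁) φ_ε(x₂)`. -/
def prodMode (L : ℝ) (k : Fin 3 → ℤ) (ε : ℝ) (X : Config 2) : ℂ :=
  ((phiMode L k ε (X 0) * phiMode L k ε (X 1) : ℝ) : ℂ)

theorem contDiff_prodMode (L : ℝ) (k : Fin 3 → ℤ) (ε : ℝ) : ContDiff ℝ 1 (prodMode L k ε) := by
  have h0 : ContDiff ℝ 1 fun X : Config 2 => phiMode L k ε (X 0) :=
    (contDiff_phiMode L k ε).comp (contDiff_apply ℝ Space 0)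
  have h1 : ContDiff ℝ 1 fun X : Config 2 => phiMode L k ε (X 1) :=
    (contDiff_phiMode L k ε).comp (contDiff_apply ℝ Space 1)
  exact Complex.ofRealCLM.contDiff.comp (h0.mul h1)

theorem continuous_prodMode (L : ℝ) (k : Fin 3 → ℤ) (ε : ℝ) : Continuous (prodMode L k ε) :=
  (contDiff_prodMode L k ε).continuous

theorem prodMode_periodic {L : ℝ} (hL : L ≠ 0) (k : Fin 3 → ℤ) (ε : ℝ) (X : Config 2) (i : Fin 2)
    (a : Fin 3) : prodMode L k ε (X + Pi.single i (EuclideanSpace.single a L)) = prodMode L k ε X := by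
  have hj : ∀ j : Fin 2, phiMode L k ε ((X + (Pi.single i (EuclideanSpace.single a L) : Config 2)) j) =
      phiMode L k ε (X j) := by
    intro j
    rw [Pi.add_apply]
    by_cases h : j = i
    · subst h
      rw [Pi.single_eq_same, phiMode_periodic hL]
    · rw [Pi.single_eq_of_ne h, add_zero]
  unfold prodMode
  rw [hj 0, hj 1]

theorem prodMode_symm (L : ℝ) (k : Fin 3 → ℤ) (ε : ℝ) (σ : Equiv.Perm (Fin 2)) (X : Config 2) :
    prodMode L k ε (X ∘ σ) = prodMode L k ε X := by
  unfold prodMode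
  have h : ∀ Y : Config 2, phiMode L k ε (Y 0) * phiMode L k ε (Y 1) = ∏ i, phiMode L k ε (Y i) :=
    fun Y => (Fin.prod_univ_two (fun i => phiMode L k ε (Y i))).symm
  rw [h, h]
  congr 1
  exact Equiv.prod_comp σ (fun i => phiMode L k ε (X i))

theorem norm_prodMode_sq (L : ℝ) (k : Fin 3 → ℤ) (ε : ℝ) (X : Config 2) :
    ‖prodMode L k ε X‖ ^ 2 = phiMode L k ε (X 0) ^ 2 * phiMode L k ε (X 1) ^ 2 := by
  unfold prodMode
  rw [Complex.norm_real, Real.norm_eq_abs, sq_abs, mul_pow]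

theorem prodMode_ne_zero {L : ℝ} {k : Fin 3 → ℤ} {ε : ℝ} (hε : |ε| < 1 / 2) (X : Config 2) :
    prodMode L k ε X ≠ 0 := by
  unfold prodMode
  exact_mod_cast (mul_pos (phiMode_pos hε (X 0)) (phiMode_pos hε (X 1))).ne'

/-- The centre of the cell, for both particles. -/
def centre (L : ℝ) : Config 2 := fun _ => WithLp.toLp 2 fun _ => L / 2

theorem centre_mem {L : ℝ} (hL : 0 < L) (i : Fin 2) (a : Fin 3) : centre L i a ∈ Set.Ioo 0 L := by
  simp only [centre]
  constructor <;> linarith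

theorem lintegral_prodMode_ne_zero {L : ℝ} (hL : 0 < L) (k : Fin 3 → ℤ) {ε : ℝ} (hε : |ε| < 1 / 2) :
    ∫⁻ X in cellN 2 L, (‖prodMode L k ε X‖₊ : ℝ≥0∞) ^ 2 ≠ 0 :=
  (lintegral_cellN_pos (continuous_prodMode L k ε) (centre_mem hL) (prodMode_ne_zero hε _)).ne'

theorem lintegral_prodMode_ne_top (L : ℝ) (k : Fin 3 → ℤ) (ε : ℝ) :
    ∫⁻ X in cellN 2 L, (‖prodMode L k ε X‖₊ : ℝ≥0∞) ^ 2 ≠ ⊤ :=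
  lintegral_cellN_nnnorm_sq_ne_top (continuous_prodMode L k ε) L

/-- **The witness state** `Ψ_ε = Φ_ε/‖Φ_ε‖` on the torus of side `L` (two bosons). -/
def twoBodyMode {L : ℝ} (hL : 0 < L) (k : Fin 3 → ℤ) {ε : ℝ} (hε : |ε| < 1 / 2) :
    PeriodicTrialState 2 L :=
  PeriodicTrialState.ofFun (prodMode L k ε) (contDiff_prodMode L k ε) (prodMode_periodic hL.ne' k ε)
    (prodMode_symm L k ε) (lintegral_prodMode_ne_zero hL k hε) (lintegral_prodMode_ne_top L k ε)

/-- The normalisation constant of the witness. -/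
def normC (L : ℝ) (k : Fin 3 → ℤ) (ε : ℝ) : ℝ :=
  (Real.sqrt (∫⁻ X in cellN 2 L, (‖prodMode L k ε X‖₊ : ℝ≥0∞) ^ 2).toReal)⁻¹

theorem normC_pos {L : ℝ} (hL : 0 < L) (k : Fin 3 → ℤ) {ε : ℝ} (hε : |ε| < 1 / 2) :
    0 < normC L k ε := by
  unfold normC
  exact inv_pos.mpr (Real.sqrt_pos.mpr
    (ENNReal.toReal_pos (lintegral_prodMode_ne_zero hL k hε) (lintegral_prodMode_ne_top L k ε)))

theorem twoBodyMode_apply {L : ℝ} (hL : 0 < L) (k : Fin 3 → ℤ) {ε : ℝ} (hε : |ε| < 1 / 2)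
    (X : Config 2) : (twoBodyMode hL k hε).ψ X = (normC L k ε : ℂ) * prodMode L k ε X := by
  simp only [twoBodyMode, PeriodicTrialState.ofFun_apply, normC, Complex.ofReal_inv]

theorem norm_twoBodyMode_sq {L : ℝ} (hL : 0 < L) (k : Fin 3 → ℤ) {ε : ℝ} (hε : |ε| < 1 / 2)
    (X : Config 2) : ‖(twoBodyMode hL k hε).ψ X‖ ^ 2 =
      normC L k ε ^ 2 * (phiMode L k ε (X 0) ^ 2 * phiMode L k ε (X 1) ^ 2) := by
  rw [twoBodyMode_apply, norm_mul, mul_pow, norm_prodMode_sq, Complex.norm_real, Real.norm_eq_abs,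
    sq_abs]

/-- **The density modulation of the witness**: `⟨cos θ_k(x₁) + cos θ_k(x₂)⟩_{Ψ_ε} =
4 c² ε (1 + 2ε²) L⁶ > 0` for `ε > 0`. -/
theorem cosMean_twoBodyMode {L : ℝ} (hL : 0 < L) {k : Fin 3 → ℤ} (hk : k ≠ 0) {ε : ℝ}
    (hε : |ε| < 1 / 2) :
    cosMean L k (twoBodyMode hL k hε) =
      normC L k ε ^ 2 * (2 * (2 * ε * L ^ 3) * ((1 + 2 * ε ^ 2) * L ^ 3)) := by
  unfold cosMean
  have hpt : ∀ X : Config 2,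
      (∑ j : Fin 2, Real.cos (2 * Real.pi / L * ∑ i, (k i : ℝ) * X j i)) *
          ‖(twoBodyMode hL k hε).ψ X‖ ^ 2 =
        normC L k ε ^ 2 *
          ((Real.cos (arg L k (X 0)) * phiMode L k ε (X 0) ^ 2) * phiMode L k ε (X 1) ^ 2 +
            phiMode L k ε (X 0) ^ 2 * (Real.cos (arg L k (X 1)) * phiMode L k ε (X 1) ^ 2)) := by
    intro X
    rw [norm_twoBodyMode_sq, Fin.sum_univ_two]
    simp only [arg]
    ring
  simp_rw [hpt]
  rw [integral_const_mul]
  congr 1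
  have i1 : Integrable (fun X : Config 2 => (Real.cos (arg L k (X 0)) * phiMode L k ε (X 0) ^ 2) *
      phiMode L k ε (X 1) ^ 2) (volume.restrict (cellN 2 L)) :=
    integrableOn_cellN (by fun_prop) L
  have i2 : Integrable (fun X : Config 2 => phiMode L k ε (X 0) ^ 2 *
      (Real.cos (arg L k (X 1)) * phiMode L k ε (X 1) ^ 2)) (volume.restrict (cellN 2 L)) :=
    integrableOn_cellN (by fun_prop) L
  rw [integral_add i1 i2,
    integral_cellN_two_mul (fun x => Real.cos (arg L k x) * phiMode L k ε x ^ 2)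
      (fun x => phiMode L k ε x ^ 2),
    integral_cellN_two_mul (fun x => phiMode L k ε x ^ 2)
      (fun x => Real.cos (arg L k x) * phiMode L k ε x ^ 2),
    integral_cell_cos_mul_phiMode_sq hL hk, integral_cell_phiMode_sq hL hk]
  ring

theorem cosMean_twoBodyMode_pos {L : ℝ} (hL : 0 < L) {k : Fin 3 → ℤ} (hk : k ≠ 0) {ε : ℝ}
    (hε : |ε| < 1 / 2) (hε0 : 0 < ε) : 0 < cosMean L k (twoBodyMode hL k hε) := by
  rw [cosMean_twoBodyMode hL hk hε]
  have := normC_pos hL k hε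
  positivity

/-- **The witness overlaps the hard core**: its periodic energy is `⊤`. -/
theorem periodicEnergy_twoBodyMode_hardCore {L : ℝ} (hL : 0 < L) (k : Fin 3 → ℤ) {ε : ℝ}
    (hε : |ε| < 1 / 2) : periodicEnergy hardCore (twoBodyMode hL k hε) = ⊤ := by
  -- the open set of configurations inside the open cell with the two particles at distance < 1
  set S : Set (Config 2) := {X | ∀ i a, X i a ∈ Set.Ioo 0 L} ∩ {X | dist (X 0) (X 1) < 1} with hS
  have hSo : IsOpen S := by
    refine IsOpen.inter ?_ (isOpen_lt (by fun_prop) continuous_const)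
    have hrw : {X : Config 2 | ∀ i a, X i a ∈ Set.Ioo 0 L} =
        ⋂ i, ⋂ a, (fun X : Config 2 => X i a) ⁻¹' Set.Ioo 0 L := by
      ext X; simp
    rw [hrw]
    exact isOpen_iInter_of_finite fun i => isOpen_iInter_of_finite fun a =>
      isOpen_Ioo.preimage (by fun_prop)
  have hSne : (centre L) ∈ S := ⟨centre_mem hL, by simp [centre]⟩
  have hSpos : 0 < volume S := hSo.measure_pos volume ⟨_, hSne⟩
  have hScell : S ⊆ cellN 2 L := fun X hX i a => Set.Ioo_subset_Ico_self (hX.1 i a)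
  -- on `S` the integrand is `⊤`
  have htop : ∀ X ∈ S, kineticDensity (twoBodyMode hL k hε).ψ X +
      periodicInteraction hardCore L X * (‖(twoBodyMode hL k hε).ψ X‖₊ : ℝ≥0∞) ^ 2 = ⊤ := by
    intro X hX
    have hcore : periodicInteraction hardCore L X = ⊤ := by
      apply top_unique
      have h1 : hardCore ‖X 0 - X 1‖ = ⊤ := hardCore_of_le_one (by rw [← dist_eq_norm]; exact hX.2.le)
      calc (⊤ : ℝ≥0∞) = hardCore ‖X 0 - X 1‖ := h1.symm
        _ ≤ periodizedPotential hardCore L (X 0 - X 1) := le_periodizedPotential _ _ _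
        _ ≤ ∑ j : Fin 2 with (0 : Fin 2) < j, periodizedPotential hardCore L (X 0 - X j) :=
            Finset.single_le_sum (f := fun j => periodizedPotential hardCore L (X 0 - X j))
              (fun _ _ => zero_le) (Finset.mem_filter.2 ⟨Finset.mem_univ _, Fin.zero_lt_one⟩)
        _ ≤ periodicInteraction hardCore L X :=
            Finset.single_le_sum (f := fun i : Fin 2 => ∑ j : Fin 2 with i < j,
              periodizedPotential hardCore L (X i - X j)) (fun _ _ => zero_le) (Finset.mem_univ 0)
    have hψ : ((‖(twoBodyMode hL k hε).ψ X‖₊ : ℝ≥0∞)) ^ 2 ≠ 0 := by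
      apply pow_ne_zero
      rw [ne_eq, ENNReal.coe_eq_zero, nnnorm_eq_zero, twoBodyMode_apply]
      exact mul_ne_zero (by exact_mod_cast (normC_pos hL k hε).ne') (prodMode_ne_zero hε X)
    rw [hcore, ENNReal.top_mul hψ, add_top]
  apply top_unique
  calc (⊤ : ℝ≥0∞) = ∫⁻ _ in S, (⊤ : ℝ≥0∞) := by
        rw [setLIntegral_const, ENNReal.top_mul hSpos.ne']
    _ = ∫⁻ X in S, kineticDensity (twoBodyMode hL k hε).ψ X +
          periodicInteraction hardCore L X * (‖(twoBodyMode hL k hε).ψ X‖₊ : ℝ≥0∞) ^ 2 :=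
        (setLIntegral_congr_fun hSo.measurableSet fun X hX => (htop X hX).symm)
    _ ≤ periodicEnergy hardCore (twoBodyMode hL k hε) := lintegral_mono_set hScell

/-- **The finite-energy guard is load-bearing**: witness `v` = hard core of radius 1,
`ρ = ρ₀/2`, `N = 2`, `k = e₀`, `Ψ = Ψ_{1/4}` (energy `⊤`, `toReal = 0`, modulation `X > 0`),
`t = -s` with `s = X·max(ρa,p²)/(4C)`: the inequality would force `E₀.toReal ≤ -sX/2 < 0`. -/
theorem not_staticResponseBoundWithoutFiniteEnergy : ¬ StaticResponseBoundWithoutFiniteEnergy := by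
  intro h
  obtain ⟨ρ₀, hρ₀, C, hC, hB⟩ := h hardCore isRepulsiveFiniteRange_hardCore
  have hρ : (0 : ℝ) < ρ₀ / 2 := by positivity
  have hL : 0 < sideLength (ρ₀ / 2) 2 := sideLength_pos hρ two_pos
  have hε : |(1 / 4 : ℝ)| < 1 / 2 := by rw [abs_of_pos (by norm_num)]; norm_num
  set Ψ := twoBodyMode hL e0 hε with hΨ
  set X := cosMean (sideLength (ρ₀ / 2) 2) e0 Ψ with hX
  have hXpos : 0 < X := cosMean_twoBodyMode_pos hL e0_ne_zero hε (by norm_num)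
  set M := max (ρ₀ / 2 * (scatteringLength hardCore).toReal) (psq (sideLength (ρ₀ / 2) 2) e0) with hM
  have hMpos : 0 < M := lt_max_of_lt_right (psq_e0_pos hL)
  set s := X * M / (4 * C) with hs
  have hspos : 0 < s := by positivity
  have key := hB (ρ₀ / 2) hρ (by linarith) 2 e0 e0_ne_zero (-s) Ψ
  unfold Ineq at key
  rw [periodicEnergy_twoBodyMode_hardCore hL e0 hε, ENNReal.toReal_top, ← hM, ← hX] at key
  have hE0 : 0 ≤ (periodicGroundStateEnergy hardCore 2 (sideLength (ρ₀ / 2) 2)).toReal :=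
    ENNReal.toReal_nonneg
  have h1 : C * (-s) ^ 2 * (2 : ℕ) / M = s * X / 2 := by
    rw [hs]
    field_simp
    ring
  rw [h1] at key
  nlinarith

/-! ## §C  Tightness: no constant `C < 1/2` can work (for ANY interaction `v`)

One particle feels no interaction, so the `N = 1` instances of the crux are statements about
the free Laplacian on the torus, whatever `v` is.  The modulated mode `φ_ε = 1 + 2ε cos θ_k`
has `⟨cos θ_k⟩ = 2ε/(1+2ε²)` and kinetic energy `2ε²|p|²/(1+2ε²)`; the discriminant form then
forces `C ≥ 1/(2(1+2ε²))`, i.e. `C ≥ 1/2` as `ε → 0` (the free static response `N/(2p²)`).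
Bogoliubov's `N/(2(p² + 16πρa))` says `1/2` should also SUFFICE perturbatively; the crux only
asks for some `C`, so this pins the sharp constant from below, it does not refute. -/

/-- The phase as a continuous linear functional: `θ_k = (2π/L) ∑ᵢ kᵢ projᵢ`. -/
def argCLM (L : ℝ) (k : Fin 3 → ℤ) : Space →L[ℝ] ℝ :=
  (2 * Real.pi / L) • ∑ i : Fin 3, (k i : ℝ) • PiLp.proj (𝕜 := ℝ) 2 (fun _ : Fin 3 => ℝ) i

theorem argCLM_apply (L : ℝ) (k : Fin 3 → ℤ) (x : Space) : argCLM L k x = arg L k x := by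
  simp [argCLM, arg]

theorem argCLM_single (L : ℝ) (k : Fin 3 → ℤ) (j : Fin 3) :
    argCLM L k (EuclideanSpace.single j (1 : ℝ)) = 2 * Real.pi / L * k j := by
  rw [argCLM_apply]
  unfold arg
  congr 1
  simp [PiLp.single_apply, Finset.sum_ite_eq']

/-- `dφ_ε(x) = -2ε sin θ_k(x) · θ_k`. -/
theorem hasFDerivAt_phiMode (L : ℝ) (k : Fin 3 → ℤ) (ε : ℝ) (x : Space) :
    HasFDerivAt (phiMode L k ε) ((2 * ε * -Real.sin (arg L k x)) • argCLM L k) x := by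
  have h1 : HasFDerivAt (fun y => Real.cos (argCLM L k y))
      ((-Real.sin (argCLM L k x)) • argCLM L k) x :=
    (Real.hasDerivAt_cos (argCLM L k x)).comp_hasFDerivAt x (argCLM L k).hasFDerivAt
  have h2 := (h1.const_mul (2 * ε)).const_add 1
  rw [argCLM_apply, smul_smul] at h2
  have hfun : (fun y => 1 + 2 * ε * Real.cos (argCLM L k y)) = phiMode L k ε := by
    funext y; rw [argCLM_apply]; rfl
  rw [hfun] at h2
  exact h2

/-- The one-body amplitude `X ↦ φ_ε(x₁)` on `Config 1`. -/
def oneMode (L : ℝ) (k : Fin 3 → ℤ) (ε : ℝ) (X : Config 1) : ℂ :=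
  ((phiMode L k ε (X 0) : ℝ) : ℂ)

theorem contDiff_oneMode (L : ℝ) (k : Fin 3 → ℤ) (ε : ℝ) : ContDiff ℝ 1 (oneMode L k ε) :=
  Complex.ofRealCLM.contDiff.comp ((contDiff_phiMode L k ε).comp (contDiff_apply ℝ Space 0))

theorem continuous_oneMode (L : ℝ) (k : Fin 3 → ℤ) (ε : ℝ) : Continuous (oneMode L k ε) :=
  (contDiff_oneMode L k ε).continuous

theorem oneMode_periodic {L : ℝ} (hL : L ≠ 0) (k : Fin 3 → ℤ) (ε : ℝ) (X : Config 1) (i : Fin 1)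
    (a : Fin 3) : oneMode L k ε (X + Pi.single i (EuclideanSpace.single a L)) = oneMode L k ε X := by
  unfold oneMode
  rw [Subsingleton.elim i 0, Pi.add_apply, Pi.single_eq_same, phiMode_periodic hL]

theorem oneMode_symm (L : ℝ) (k : Fin 3 → ℤ) (ε : ℝ) (σ : Equiv.Perm (Fin 1)) (X : Config 1) :
    oneMode L k ε (X ∘ σ) = oneMode L k ε X := by
  rw [Subsingleton.elim σ 1]; rfl

theorem oneMode_ne_zero {L : ℝ} {k : Fin 3 → ℤ} {ε : ℝ} (hε : |ε| < 1 / 2) (X : Config 1) :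
    oneMode L k ε X ≠ 0 := by
  unfold oneMode
  exact_mod_cast (phiMode_pos hε (X 0)).ne'

def centre1 (L : ℝ) : Config 1 := fun _ => WithLp.toLp 2 fun _ => L / 2

theorem centre1_mem {L : ℝ} (hL : 0 < L) (i : Fin 1) (a : Fin 3) : centre1 L i a ∈ Set.Ioo 0 L := by
  simp only [centre1]
  constructor <;> linarith

theorem lintegral_oneMode_ne_zero {L : ℝ} (hL : 0 < L) (k : Fin 3 → ℤ) {ε : ℝ} (hε : |ε| < 1 / 2) :
    ∫⁻ X in cellN 1 L, (‖oneMode L k ε X‖₊ : ℝ≥0∞) ^ 2 ≠ 0 :=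
  (lintegral_cellN_pos (continuous_oneMode L k ε) (centre1_mem hL) (oneMode_ne_zero hε _)).ne'

theorem lintegral_oneMode_ne_top (L : ℝ) (k : Fin 3 → ℤ) (ε : ℝ) :
    ∫⁻ X in cellN 1 L, (‖oneMode L k ε X‖₊ : ℝ≥0∞) ^ 2 ≠ ⊤ :=
  lintegral_cellN_nnnorm_sq_ne_top (continuous_oneMode L k ε) L

/-- The value of the normalisation integral: `∫_{cell¹} |φ_ε(x₁)|² = (1 + 2ε²) L³`. -/
theorem lintegral_oneMode_eq {L : ℝ} (hL : 0 < L) {k : Fin 3 → ℤ} (hk : k ≠ 0) (ε : ℝ) :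
    ∫⁻ X in cellN 1 L, (‖oneMode L k ε X‖₊ : ℝ≥0∞) ^ 2 = ENNReal.ofReal ((1 + 2 * ε ^ 2) * L ^ 3) := by
  have hpt : ∀ X : Config 1, ((‖oneMode L k ε X‖₊ : ℝ≥0∞)) ^ 2 =
      ENNReal.ofReal (phiMode L k ε (X 0) ^ 2) := by
    intro X
    rw [coe_nnnorm_sq_eq_ofReal, oneMode, Complex.norm_real, Real.norm_eq_abs, sq_abs]
  simp_rw [hpt]
  have hint : Integrable (fun X : Config 1 => phiMode L k ε (X 0) ^ 2) (volume.restrict (cellN 1 L)) :=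
    integrableOn_cellN (by fun_prop) L
  rw [← ofReal_integral_eq_lintegral_ofReal hint (Filter.Eventually.of_forall fun X => sq_nonneg _),
    integral_cellN_one L (fun x => phiMode L k ε x ^ 2), integral_cell_phiMode_sq hL hk]

/-- **The one-body witness state** `Ψ_ε = φ_ε(x₁)/‖φ_ε‖` (one boson on the torus of side `L`). -/
def oneBodyMode {L : ℝ} (hL : 0 < L) (k : Fin 3 → ℤ) {ε : ℝ} (hε : |ε| < 1 / 2) :
    PeriodicTrialState 1 L :=
  PeriodicTrialState.ofFun (oneMode L k ε) (contDiff_oneMode L k ε) (oneMode_periodic hL.ne' k ε)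
    (oneMode_symm L k ε) (lintegral_oneMode_ne_zero hL k hε) (lintegral_oneMode_ne_top L k ε)

/-- Its normalisation constant `c = ((1+2ε²)L³)^{-1/2}`. -/
def normC1 (L : ℝ) (k : Fin 3 → ℤ) (ε : ℝ) : ℝ :=
  (Real.sqrt (∫⁻ X in cellN 1 L, (‖oneMode L k ε X‖₊ : ℝ≥0∞) ^ 2).toReal)⁻¹

theorem normC1_sq {L : ℝ} (hL : 0 < L) {k : Fin 3 → ℤ} (hk : k ≠ 0) (ε : ℝ) :
    normC1 L k ε ^ 2 = ((1 + 2 * ε ^ 2) * L ^ 3)⁻¹ := by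
  unfold normC1
  rw [lintegral_oneMode_eq hL hk, ENNReal.toReal_ofReal (by positivity), inv_pow,
    Real.sq_sqrt (by positivity)]

theorem normC1_pos {L : ℝ} (hL : 0 < L) {k : Fin 3 → ℤ} (hk : k ≠ 0) (ε : ℝ) : 0 < normC1 L k ε := by
  unfold normC1
  rw [lintegral_oneMode_eq hL hk, ENNReal.toReal_ofReal (by positivity)]
  positivity

theorem oneBodyMode_apply {L : ℝ} (hL : 0 < L) (k : Fin 3 → ℤ) {ε : ℝ} (hε : |ε| < 1 / 2)
    (X : Config 1) : (oneBodyMode hL k hε).ψ X = (normC1 L k ε : ℂ) * oneMode L k ε X := by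
  simp only [oneBodyMode, PeriodicTrialState.ofFun_apply, normC1, Complex.ofReal_inv]

theorem oneBodyMode_eq_ofReal {L : ℝ} (hL : 0 < L) (k : Fin 3 → ℤ) {ε : ℝ} (hε : |ε| < 1 / 2)
    (X : Config 1) : (oneBodyMode hL k hε).ψ X = ((normC1 L k ε * phiMode L k ε (X 0) : ℝ) : ℂ) := by
  rw [oneBodyMode_apply]; unfold oneMode; push_cast; ring

/-- **Density modulation of the one-body witness**: `⟨cos θ_k⟩_{Ψ_ε} = c² · 2εL³ = 2ε/(1+2ε²)`. -/
theorem cosMean_oneBodyMode {L : ℝ} (hL : 0 < L) {k : Fin 3 → ℤ} (hk : k ≠ 0) {ε : ℝ}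
    (hε : |ε| < 1 / 2) :
    cosMean L k (oneBodyMode hL k hε) = normC1 L k ε ^ 2 * (2 * ε * L ^ 3) := by
  unfold cosMean
  have hpt : ∀ X : Config 1,
      (∑ j : Fin 1, Real.cos (2 * Real.pi / L * ∑ i, (k i : ℝ) * X j i)) *
          ‖(oneBodyMode hL k hε).ψ X‖ ^ 2 =
        normC1 L k ε ^ 2 * (Real.cos (arg L k (X 0)) * phiMode L k ε (X 0) ^ 2) := by
    intro X
    rw [oneBodyMode_eq_ofReal, Complex.norm_real, Real.norm_eq_abs, sq_abs, Fin.sum_univ_one]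
    simp only [arg]
    ring
  simp_rw [hpt]
  rw [integral_const_mul, integral_cellN_one L (fun x => Real.cos (arg L k x) * phiMode L k ε x ^ 2),
    integral_cell_cos_mul_phiMode_sq hL hk]

/-- The directional derivatives of the witness: `∂_{1,j}Ψ_ε = c · (-2ε sin θ_k(x₁)) · (2π kⱼ/L)`. -/
theorem fderiv_oneBodyMode {L : ℝ} (hL : 0 < L) (k : Fin 3 → ℤ) {ε : ℝ} (hε : |ε| < 1 / 2)
    (X : Config 1) (j : Fin 3) :
    fderiv ℝ (oneBodyMode hL k hε).ψ X (Pi.single 0 (EuclideanSpace.single j 1)) =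
      ((normC1 L k ε * (2 * ε * -Real.sin (arg L k (X 0)) * (2 * Real.pi / L * k j)) : ℝ) : ℂ) := by
  -- the state is `ofRealCLM ∘ (c • φ_ε) ∘ proj₀`
  have hφ : HasFDerivAt (fun x => normC1 L k ε * phiMode L k ε x)
      (normC1 L k ε • ((2 * ε * -Real.sin (arg L k (X 0))) • argCLM L k)) (X 0) :=
    (hasFDerivAt_phiMode L k ε (X 0)).const_mul _
  have hproj : HasFDerivAt (fun Y : Config 1 => Y 0)
      (ContinuousLinearMap.proj (R := ℝ) (φ := fun _ : Fin 1 => Space) 0) X := hasFDerivAt_apply 0 X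
  have hcomp := (Complex.ofRealCLM.hasFDerivAt.comp (X 0) hφ).comp X hproj
  have hfun : (oneBodyMode hL k hε).ψ =
      (Complex.ofRealCLM ∘ fun x => normC1 L k ε * phiMode L k ε x) ∘ fun Y : Config 1 => Y 0 := by
    funext Y; rw [oneBodyMode_eq_ofReal]; rfl
  rw [hfun, hcomp.fderiv]
  simp [argCLM_single]

/-- **Kinetic density of the witness**: `|∇Ψ_ε|² = c² · 4ε² sin² θ_k(x₁) · |p|²`. -/
theorem kineticDensity_oneBodyMode {L : ℝ} (hL : 0 < L) (k : Fin 3 → ℤ) {ε : ℝ} (hε : |ε| < 1 / 2)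
    (X : Config 1) :
    kineticDensity (oneBodyMode hL k hε).ψ X =
      ENNReal.ofReal (normC1 L k ε ^ 2 * (4 * ε ^ 2 * Real.sin (arg L k (X 0)) ^ 2 * psq L k)) := by
  unfold kineticDensity
  rw [Fin.sum_univ_one]
  simp_rw [fderiv_oneBodyMode hL k hε X, coe_nnnorm_sq_eq_ofReal, Complex.norm_real, Real.norm_eq_abs,
    sq_abs]
  have hsum : normC1 L k ε ^ 2 * (4 * ε ^ 2 * Real.sin (arg L k (X 0)) ^ 2 * psq L k) =
      ∑ j : Fin 3, (normC1 L k ε * (2 * ε * -Real.sin (arg L k (X 0)) * (2 * Real.pi / L * (k j : ℝ)))) ^ 2 := by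
    unfold psq
    rw [Finset.mul_sum, Finset.mul_sum, Finset.mul_sum]
    refine Finset.sum_congr rfl fun j _ => ?_
    ring
  rw [hsum, ENNReal.ofReal_sum_of_nonneg (fun j _ => sq_nonneg _)]

/-- **Energy of the witness** (one particle: no interaction): `⟨Ψ_ε, HΨ_ε⟩ = c² · 2ε²|p|²L³`. -/
theorem periodicEnergy_oneBodyMode {L : ℝ} (hL : 0 < L) {k : Fin 3 → ℤ} (hk : k ≠ 0) {ε : ℝ}
    (hε : |ε| < 1 / 2) (v : ℝ → ℝ≥0∞) :
    periodicEnergy v (oneBodyMode hL k hε) =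
      ENNReal.ofReal (normC1 L k ε ^ 2 * (2 * ε ^ 2 * psq L k * L ^ 3)) := by
  unfold periodicEnergy
  have hint0 : ∀ X : Config 1, periodicInteraction v L X = 0 := by
    intro X; simp [periodicInteraction]
  simp_rw [hint0, zero_mul, add_zero, kineticDensity_oneBodyMode hL k hε]
  have hint : Integrable (fun X : Config 1 => normC1 L k ε ^ 2 *
      (4 * ε ^ 2 * Real.sin (arg L k (X 0)) ^ 2 * psq L k)) (volume.restrict (cellN 1 L)) :=
    integrableOn_cellN (by fun_prop) L
  rw [← ofReal_integral_eq_lintegral_ofReal hint (Filter.Eventually.of_forall fun X => by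
    have := psq_nonneg L k; positivity)]
  congr 1
  rw [integral_const_mul, integral_cellN_one L (fun x => 4 * ε ^ 2 * Real.sin (arg L k x) ^ 2 * psq L k)]
  have hsin : (fun x => 4 * ε ^ 2 * Real.sin (arg L k x) ^ 2 * psq L k) = fun x =>
      (2 * ε ^ 2 * psq L k + 0 * Real.cos (arg L k x) + (-(2 * ε ^ 2 * psq L k)) *
        Real.cos (arg L ((2 : ℤ) • k) x) + 0 * Real.cos (arg L ((3 : ℤ) • k) x)) := by
    funext x
    rw [arg_intSMul, show ((2 : ℤ) : ℝ) * arg L k x = 2 * arg L k x by push_cast; ring,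
      Real.cos_two_mul, Real.cos_sq']
    ring
  rw [hsin, integral_cell_trig_combo hL hk]

/-- **Core one-particle bound**: if the body holds with constants `(ρ₀, C)` for SOME interaction
`v`, then testing it at `ρ = ρ₀/2`, `N = 1`, `k = e₀` on `Ψ_ε` (`0 < ε < 1/2`) gives `C > 0` and
`max(ρa, |p|²) ≤ 2C(1 + 2ε²)|p|²` — the denominator can exceed `|p|²` by at most the factor
`2C(1+2ε²)`. -/
theorem max_le_of_body {v : ℝ → ℝ≥0∞} {ρ₀ C : ℝ} (hρ₀ : 0 < ρ₀) (hB : Body v ρ₀ C) {ε : ℝ}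
    (hε0 : 0 < ε) (hε : ε < 1 / 2) :
    0 < C ∧ max (ρ₀ / 2 * (scatteringLength v).toReal) (psq (sideLength (ρ₀ / 2) 1) e0) ≤
      2 * C * (1 + 2 * ε ^ 2) * psq (sideLength (ρ₀ / 2) 1) e0 := by
  have hε' : |ε| < 1 / 2 := by rwa [abs_of_pos hε0]
  have hρ : (0 : ℝ) < ρ₀ / 2 := by positivity
  have hL : 0 < sideLength (ρ₀ / 2) 1 := sideLength_pos hρ one_pos
  set L := sideLength (ρ₀ / 2) 1 with hLdef
  set Ψ := oneBodyMode hL e0 hε' with hΨ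
  have hEtop : periodicEnergy v Ψ ≠ ⊤ := by
    rw [hΨ, periodicEnergy_oneBodyMode hL e0_ne_zero hε' v]; exact ENNReal.ofReal_ne_top
  have key : ∀ t, Ineq v C (ρ₀ / 2) 1 e0 t Ψ := fun t =>
    hB (ρ₀ / 2) hρ (by linarith) 1 e0 e0_ne_zero t Ψ hEtop
  -- the data of the witness
  set c2 := normC1 L e0 ε ^ 2 with hc2
  have hc2val : c2 = ((1 + 2 * ε ^ 2) * L ^ 3)⁻¹ := normC1_sq hL e0_ne_zero ε
  have hp : 0 < psq L e0 := psq_e0_pos hL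
  have hX : cosMean L e0 Ψ = c2 * (2 * ε * L ^ 3) := cosMean_oneBodyMode hL e0_ne_zero hε'
  have hE : (periodicEnergy v Ψ).toReal = c2 * (2 * ε ^ 2 * psq L e0 * L ^ 3) := by
    rw [hΨ, periodicEnergy_oneBodyMode hL e0_ne_zero hε' v, ENNReal.toReal_ofReal]
    have := psq_nonneg L e0
    positivity
  have hE0 : (periodicGroundStateEnergy v 1 L).toReal = 0 := by
    rw [periodicGroundStateEnergy_one hL]; rfl
  set M := max (ρ₀ / 2 * (scatteringLength v).toReal) (psq L e0) with hM
  have hMp : psq L e0 ≤ M := le_max_right _ _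
  have hMpos : 0 < M := hp.trans_le hMp
  have hc2pos : 0 < c2 := by rw [hc2val]; positivity
  have hL3 : 0 < L ^ 3 := by positivity
  -- the inequality family, unfolded
  have key' : ∀ t : ℝ, 0 - C * (1 : ℕ) / M * t ^ 2 ≤
      c2 * (2 * ε ^ 2 * psq L e0 * L ^ 3) + t * (c2 * (2 * ε * L ^ 3)) := by
    intro t
    have h := key t
    unfold Ineq at h
    rw [hE0, hE, hX, ← hM] at h
    calc 0 - C * (1 : ℕ) / M * t ^ 2 = 0 - C * t ^ 2 * (1 : ℕ) / M := by ring
      _ ≤ _ := h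
  -- `C ≤ 0` is impossible: the left side would be `≥ 0` for all `t`, the right side can be `-1`
  have hC : 0 < C := by
    by_contra hC
    push Not at hC
    have h := key' (-(ε * psq L e0 + 1 / (c2 * (2 * ε * L ^ 3))))
    have hnn : 0 ≤ 0 - C * (1 : ℕ) / M * (-(ε * psq L e0 + 1 / (c2 * (2 * ε * L ^ 3)))) ^ 2 := by
      have : C * (1 : ℕ) / M ≤ 0 := div_nonpos_of_nonpos_of_nonneg (by simpa using hC) hMpos.le
      nlinarith [sq_nonneg (ε * psq L e0 + 1 / (c2 * (2 * ε * L ^ 3)))]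
    have hneg : c2 * (2 * ε ^ 2 * psq L e0 * L ^ 3) +
        (-(ε * psq L e0 + 1 / (c2 * (2 * ε * L ^ 3)))) * (c2 * (2 * ε * L ^ 3)) = -1 := by
      field_simp
      ring
    linarith
  refine ⟨hC, ?_⟩
  have hB' : 0 < C * (1 : ℕ) / M := by positivity
  have hdisc := (forall_quad_iff hB').1 key'
  rw [sub_zero] at hdisc
  -- `X² ≤ 4 (C/M) E`, i.e. `X² M ≤ 4 C E`
  have h1 : (c2 * (2 * ε * L ^ 3)) ^ 2 * M ≤ 4 * C * (c2 * (2 * ε ^ 2 * psq L e0 * L ^ 3)) := by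
    have := mul_le_mul_of_nonneg_right hdisc hMpos.le
    calc (c2 * (2 * ε * L ^ 3)) ^ 2 * M
        ≤ 4 * (C * (1 : ℕ) / M) * (c2 * (2 * ε ^ 2 * psq L e0 * L ^ 3)) * M := this
      _ = 4 * C * (c2 * (2 * ε ^ 2 * psq L e0 * L ^ 3)) := by
        field_simp
        push_cast
        ring
  -- divide by `4 c2² ε² L⁶ > 0` and substitute `c2 L³ (1 + 2ε²) = 1`
  have hcL : c2 * L ^ 3 * (1 + 2 * ε ^ 2) = 1 := by
    rw [hc2val]; field_simp
  have h2 : c2 * L ^ 3 * M ≤ 2 * C * psq L e0 := by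
    have h1' : 4 * c2 * ε ^ 2 * L ^ 3 * (c2 * L ^ 3 * M) ≤ 4 * c2 * ε ^ 2 * L ^ 3 * (2 * C * psq L e0) := by
      calc 4 * c2 * ε ^ 2 * L ^ 3 * (c2 * L ^ 3 * M) = (c2 * (2 * ε * L ^ 3)) ^ 2 * M := by ring
        _ ≤ 4 * C * (c2 * (2 * ε ^ 2 * psq L e0 * L ^ 3)) := h1
        _ = 4 * c2 * ε ^ 2 * L ^ 3 * (2 * C * psq L e0) := by ring
    exact le_of_mul_le_mul_left h1' (by positivity)
  calc M = (c2 * L ^ 3 * (1 + 2 * ε ^ 2)) * M := by rw [hcL, one_mul]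
    _ = (1 + 2 * ε ^ 2) * (c2 * L ^ 3 * M) := by ring
    _ ≤ (1 + 2 * ε ^ 2) * (2 * C * psq L e0) := mul_le_mul_of_nonneg_left h2 (by positivity)
    _ = 2 * C * (1 + 2 * ε ^ 2) * psq L e0 := by ring

/-- **Tightness lemma**: if the body holds with constants `(ρ₀, C)` for SOME interaction `v`,
then `C ≥ 1/(2(1+2ε²))` for every `0 < ε < 1/2`. -/
theorem le_C_of_body {v : ℝ → ℝ≥0∞} {ρ₀ C : ℝ} (hρ₀ : 0 < ρ₀) (hB : Body v ρ₀ C) {ε : ℝ}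
    (hε0 : 0 < ε) (hε : ε < 1 / 2) : 1 / (2 * (1 + 2 * ε ^ 2)) ≤ C := by
  obtain ⟨hC, hmax⟩ := max_le_of_body hρ₀ hB hε0 hε
  have hp : 0 < psq (sideLength (ρ₀ / 2) 1) e0 :=
    psq_e0_pos (sideLength_pos (by positivity) one_pos)
  have h := (le_max_right _ _).trans hmax
  rw [div_le_iff₀ (by positivity)]
  nlinarith

/-- **TIGHTNESS**: whenever the crux's body holds for an interaction `v` with constants
`(ρ₀, C)`, necessarily `C ≥ 1/2`.  Hence any proof must produce `C ≥ 1/2`; the free response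
`N/(2|p|²)` is attained in the limit `ε → 0` of the density-modulated constant mode. -/
theorem half_le_C_of_body {v : ℝ → ℝ≥0∞} {ρ₀ C : ℝ} (hρ₀ : 0 < ρ₀) (hB : Body v ρ₀ C) :
    1 / 2 ≤ C := by
  by_contra hC
  push Not at hC
  -- ε := min(1/4, (1/2 - C)/2): then 1/(2(1+2ε²)) ≥ 1/2 - ε² ≥ 1/2 - ε > C... we show C ≥ 1/4 + C/2
  set δ := min (1 / 4 : ℝ) ((1 / 2 - C) / 2) with hδ
  have hδpos : 0 < δ := lt_min (by norm_num) (by linarith)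
  have hδle : δ ≤ 1 / 4 := min_le_left _ _
  have hδle' : δ ≤ (1 / 2 - C) / 2 := min_le_right _ _
  have h := le_C_of_body hρ₀ hB hδpos (by linarith)
  -- 1/(2(1+2δ²)) ≥ (1 - 2δ²)/2
  have h1 : (1 - 2 * δ ^ 2) / 2 ≤ 1 / (2 * (1 + 2 * δ ^ 2)) := by
    rw [div_le_div_iff₀ (by norm_num) (by positivity)]
    nlinarith [sq_nonneg δ]
  have h2 : δ ^ 2 ≤ δ := by nlinarith
  linarith

/-- The crux therefore says exactly: `∀ v, ∃ ρ₀ > 0, ∃ C ≥ 1/2, Body v ρ₀ C`. -/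
theorem staticResponseBound_iff_half_le :
    BECInsertionCorrector.StaticResponseBound ↔
      ∀ v : ℝ → ℝ≥0∞, IsRepulsiveFiniteRange v →
        ∃ ρ₀ : ℝ, 0 < ρ₀ ∧ ∃ C : ℝ, 1 / 2 ≤ C ∧ Body v ρ₀ C := by
  rw [staticResponseBound_iff]
  refine forall₂_congr fun v _ => ⟨?_, ?_⟩
  · rintro ⟨ρ₀, hρ₀, C, _, hB⟩
    exact ⟨ρ₀, hρ₀, C, half_le_C_of_body hρ₀ hB, hB⟩
  · rintro ⟨ρ₀, hρ₀, C, hC, hB⟩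
    exact ⟨ρ₀, hρ₀, C, by linarith, hB⟩

/-- **Refuted strengthening**: the crux with any fixed constant `C < 1/2` is false — already
for the free gas. -/
theorem not_body_of_lt_half {C : ℝ} (hC : C < 1 / 2) (v : ℝ → ℝ≥0∞) {ρ₀ : ℝ} (hρ₀ : 0 < ρ₀) :
    ¬ Body v ρ₀ C :=
  fun hB => absurd (half_le_C_of_body hρ₀ hB) (not_le.mpr hC)

/-! ## §F  The constants cannot be uniform in the interaction (conditional)

The crux quantifies `∃ ρ₀ C` AFTER `v`.  The one-particle bound of §C also shows why: at fixed
`(ρ₀, C)` the denominator obeys `ρ₀a/2 ≤ max(ρ₀a/2, |p|²) ≤ 2C(1+2ε²)|p|²` with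
`|p|² = 4π²(ρ₀/2)^{2/3}` independent of `v`, so the scattering length of every admissible `v`
would be bounded by a constant depending on `(ρ₀, C)` only.  Hard spheres of radius `R` have
`a = R` (Newtonian capacity of the ball, `4πa = cap(B_R) = 4πR`); that computation is not in the
tree, so the unboundedness of `a` over the admissible class enters as a hypothesis. -/

/-- The crux with `(ρ₀, C)` chosen BEFORE the interaction. -/
def StaticResponseBoundUniform : Prop :=
  ∃ ρ₀ : ℝ, 0 < ρ₀ ∧ ∃ C : ℝ, 0 < C ∧ ∀ v : ℝ → ℝ≥0∞, IsRepulsiveFiniteRange v → Body v ρ₀ C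

/-- **No uniform constants** (conditional on the scattering length being unbounded over the
admissible class, e.g. `a(hard sphere of radius R) = R`): the uniform variant is false. -/
theorem not_staticResponseBoundUniform_of_unbounded_scatteringLength
    (h : ∀ A : ℝ, ∃ v : ℝ → ℝ≥0∞, IsRepulsiveFiniteRange v ∧ scatteringLength v ≠ ⊤ ∧
      A ≤ (scatteringLength v).toReal) :
    ¬ StaticResponseBoundUniform := by
  rintro ⟨ρ₀, hρ₀, C, hC, hB⟩
  set p2 := psq (sideLength (ρ₀ / 2) 1) e0 with hp2
  have hp : 0 < p2 := psq_e0_pos (sideLength_pos (by positivity) one_pos)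
  obtain ⟨v, hv, _, hA⟩ := h ((2 * C * (1 + 2 * (1 / 4 : ℝ) ^ 2) * p2 + 1) * (2 / ρ₀))
  obtain ⟨_, hmax⟩ := max_le_of_body hρ₀ (hB v hv) (ε := 1 / 4) (by norm_num) (by norm_num)
  have h1 : ρ₀ / 2 * (scatteringLength v).toReal ≤ 2 * C * (1 + 2 * (1 / 4 : ℝ) ^ 2) * p2 :=
    (le_max_left _ _).trans hmax
  have h2 : 2 * C * (1 + 2 * (1 / 4 : ℝ) ^ 2) * p2 + 1 ≤ ρ₀ / 2 * (scatteringLength v).toReal := by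
    have := mul_le_mul_of_nonneg_left hA (by positivity : (0 : ℝ) ≤ ρ₀ / 2)
    calc 2 * C * (1 + 2 * (1 / 4 : ℝ) ^ 2) * p2 + 1
        = ρ₀ / 2 * ((2 * C * (1 + 2 * (1 / 4 : ℝ) ^ 2) * p2 + 1) * (2 / ρ₀)) := by
          field_simp
      _ ≤ ρ₀ / 2 * (scatteringLength v).toReal := this
  linarith

/-- In particular the order of quantifiers in the crux (`∃ ρ₀ C` after `v`) is forced: the body
with fixed `(ρ₀, C)` fails for every admissible `v` whose scattering length exceeds
`(9C/2)|p|²/ρ₀ · 2 = 9C·4π²(ρ₀/2)^{2/3}/ρ₀`. -/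
theorem scatteringLength_le_of_body {v : ℝ → ℝ≥0∞} {ρ₀ C : ℝ} (hρ₀ : 0 < ρ₀) (hB : Body v ρ₀ C) :
    ρ₀ / 2 * (scatteringLength v).toReal ≤ 9 / 4 * C * psq (sideLength (ρ₀ / 2) 1) e0 := by
  obtain ⟨_, hmax⟩ := max_le_of_body hρ₀ hB (ε := 1 / 4) (by norm_num) (by norm_num)
  have h1 := (le_max_left _ _).trans hmax
  calc ρ₀ / 2 * (scatteringLength v).toReal ≤ 2 * C * (1 + 2 * (1 / 4 : ℝ) ^ 2) *
      psq (sideLength (ρ₀ / 2) 1) e0 := h1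
    _ = 9 / 4 * C * psq (sideLength (ρ₀ / 2) 1) e0 := by ring

/-! ## §G  Certified trivial regimes: `t = 0` and `|t| ≥ max(ρa,|p|²)/C`

What is NOT open: the inner inequality at `t = 0` (variational principle) and for
`|t| ≥ max(ρa,|p|²)/C` (the trivial floor `⟨H + t∑cos⟩ ≥ E₀ − |t|N`).  Together with the free
completed square (`|t| ≥ |p|√(E₀/((C−1)N))` on the branch `max = |p|²`, generation 1 / sibling
`srbAt_zero`) this pins the OPEN REMAINDER of the crux to the window `|t| < max(ρa,|p|²)/C` with
`N ≥ 2` interacting particles: the genuine second-order (and non-perturbative) density response. -/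

/-- The Bochner normalisation of an admissible state: `∫_{cell^N} |Ψ|² = 1`. -/
theorem integral_norm_sq_eq_one {N : ℕ} {L : ℝ} (Ψ : PeriodicTrialState N L) :
    ∫ X in cellN N L, ‖Ψ.ψ X‖ ^ 2 = 1 := by
  have hint : Integrable (fun X => ‖Ψ.ψ X‖ ^ 2) (volume.restrict (cellN N L)) :=
    integrableOn_cellN ((Ψ.contDiff.continuous.norm).pow 2) L
  have h := ofReal_integral_eq_lintegral_ofReal hint
    (Filter.Eventually.of_forall fun X => sq_nonneg _)
  simp_rw [← coe_nnnorm_sq_eq_ofReal] at h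
  rw [Ψ.norm_eq] at h
  have hnn : 0 ≤ ∫ X in cellN N L, ‖Ψ.ψ X‖ ^ 2 := integral_nonneg fun X => sq_nonneg _
  have := congrArg ENNReal.toReal h
  rwa [ENNReal.toReal_ofReal hnn, ENNReal.toReal_one] at this

/-- `|⟨∑ⱼ cos(p·xⱼ)⟩_Ψ| ≤ N`. -/
theorem abs_cosMean_le {N : ℕ} {L : ℝ} (k : Fin 3 → ℤ) (Ψ : PeriodicTrialState N L) :
    |cosMean L k Ψ| ≤ N := by
  unfold cosMean
  have hcont : Continuous fun X : Config N =>
      (∑ j, Real.cos (2 * Real.pi / L * ∑ i, (k i : ℝ) * X j i)) * ‖Ψ.ψ X‖ ^ 2 := by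
    have := Ψ.contDiff.continuous
    fun_prop
  have hpt : ∀ X : Config N,
      |(∑ j, Real.cos (2 * Real.pi / L * ∑ i, (k i : ℝ) * X j i)) * ‖Ψ.ψ X‖ ^ 2| ≤
        N * ‖Ψ.ψ X‖ ^ 2 := by
    intro X
    rw [abs_mul, abs_of_nonneg (sq_nonneg ‖Ψ.ψ X‖)]
    refine mul_le_mul_of_nonneg_right ?_ (sq_nonneg _)
    calc |∑ j, Real.cos (2 * Real.pi / L * ∑ i, (k i : ℝ) * X j i)|
        ≤ ∑ j, |Real.cos (2 * Real.pi / L * ∑ i, (k i : ℝ) * X j i)| := Finset.abs_sum_le_sum_abs _ _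
      _ ≤ ∑ _j : Fin N, (1 : ℝ) := Finset.sum_le_sum fun j _ => Real.abs_cos_le_one _
      _ = N := by simp
  have hint2 : Integrable (fun X => (N : ℝ) * ‖Ψ.ψ X‖ ^ 2) (volume.restrict (cellN N L)) :=
    (integrableOn_cellN ((Ψ.contDiff.continuous.norm).pow 2) L).const_mul _
  calc |∫ X in cellN N L, (∑ j, Real.cos (2 * Real.pi / L * ∑ i, (k i : ℝ) * X j i)) * ‖Ψ.ψ X‖ ^ 2|
      ≤ ∫ X in cellN N L, |(∑ j, Real.cos (2 * Real.pi / L * ∑ i, (k i : ℝ) * X j i)) * ‖Ψ.ψ X‖ ^ 2| :=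
        abs_integral_le_integral_abs
    _ ≤ ∫ X in cellN N L, (N : ℝ) * ‖Ψ.ψ X‖ ^ 2 :=
        integral_mono_of_nonneg (Filter.Eventually.of_forall fun X => abs_nonneg _) hint2
          (Filter.Eventually.of_forall hpt)
    _ = N := by rw [integral_const_mul, integral_norm_sq_eq_one, mul_one]

/-- **`t = 0`**: the inner inequality is the variational principle. -/
theorem ineq_zero (v : ℝ → ℝ≥0∞) (C ρ : ℝ) {N : ℕ} (k : Fin 3 → ℤ)
    (Ψ : PeriodicTrialState N (sideLength ρ N)) (hΨ : periodicEnergy v Ψ ≠ ⊤) :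
    Ineq v C ρ N k 0 Ψ := by
  unfold Ineq
  have hE := ENNReal.toReal_mono hΨ (periodicGroundStateEnergy_le v Ψ)
  simpa using hE

/-- **`N = 0`**: no particles, no density wave (`∑ over Fin 0 = 0`); the inequality is
`E₀ ≤ E_Ψ` again (here `sideLength ρ 0 = 0` and `cellN 0 0 = univ`, harmless junk). -/
theorem ineq_N_zero (v : ℝ → ℝ≥0∞) (C ρ : ℝ) (k : Fin 3 → ℤ) (t : ℝ)
    (Ψ : PeriodicTrialState 0 (sideLength ρ 0)) (hΨ : periodicEnergy v Ψ ≠ ⊤) :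
    Ineq v C ρ 0 k t Ψ := by
  unfold Ineq cosMean
  have hE := ENNReal.toReal_mono hΨ (periodicGroundStateEnergy_le v Ψ)
  simpa using hE

/-- **Large coupling**: for `|t| ≥ max(ρa,|p|²)/C` the inner inequality follows from the
trivial floor `t⟨∑cos⟩ ≥ −|t|N` and `E₀ ≤ E_Ψ`. -/
theorem ineq_of_large_t (v : ℝ → ℝ≥0∞) {C : ℝ} (hC : 0 < C) (ρ : ℝ) {N : ℕ} (k : Fin 3 → ℤ)
    {t : ℝ} (Ψ : PeriodicTrialState N (sideLength ρ N)) (hΨ : periodicEnergy v Ψ ≠ ⊤)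
    (hM : 0 < max (ρ * (scatteringLength v).toReal) (psq (sideLength ρ N) k))
    (ht : max (ρ * (scatteringLength v).toReal) (psq (sideLength ρ N) k) / C ≤ |t|) :
    Ineq v C ρ N k t Ψ := by
  unfold Ineq
  set M := max (ρ * (scatteringLength v).toReal) (psq (sideLength ρ N) k) with hMdef
  set X := cosMean (sideLength ρ N) k Ψ
  have hE := ENNReal.toReal_mono hΨ (periodicGroundStateEnergy_le v Ψ)
  have hX : |X| ≤ N := abs_cosMean_le k Ψ
  have hN : (0 : ℝ) ≤ N := by positivity
  have htX : -(|t| * N) ≤ t * X := by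
    have h1 := neg_abs_le (t * X)
    rw [abs_mul] at h1
    nlinarith [abs_nonneg t, abs_nonneg X]
  have h1 : M ≤ C * |t| := by rwa [div_le_iff₀' hC] at ht
  have h2 : |t| * N ≤ C * t ^ 2 * N / M := by
    rw [le_div_iff₀ hM, ← sq_abs t]
    have := mul_le_mul_of_nonneg_left h1 (mul_nonneg (abs_nonneg t) hN)
    nlinarith
  linarith

/-! ## §H  Round-1 typed first lemmas that are FALSE AS TYPED (Bochner junk through
non-integrable charges) — verbatim copies of `SketchIdeator3.lean` -/

/-- VERBATIM copy of `Sketch.FibreSubadditivity` (SketchIdeator3.lean, card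
`fibre-centering-free-branch`, second lemma). -/
def FibreSubadditivity : Prop :=
  ∀ (N : ℕ) (L : ℝ) (F : Config N → ℝ) (θ : Fin N → Config N → ℝ) (c : Fin N → ℝ),
    0 < L → Continuous F → (∀ i, 0 ≤ c i) →
    (∀ i, ∀ φ : Config N → ℝ, IsPeriodicTest L φ →
      (∫ X in cellN N L, θ i X * φ X * F X ^ 2) ^ 2 ≤
        c i * ∫ X in cellN N L, (∑ k, pderiv i k φ X ^ 2) * F X ^ 2) →
    hMinusOneSqW L F (fun X => ∑ i, θ i X) ≤ ENNReal.ofReal (∑ i, c i)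

/-- VERBATIM copy of `Sketch.ScreenedFluxBound` (SketchIdeator3.lean, card
`feynman-defect-screened-flux`, second lemma). -/
def ScreenedFluxBound : Prop :=
  ∀ (N : ℕ) (L : ℝ) (F g w r δ : Config N → ℝ) (s : ℝ), 0 < L → Continuous F →
    IsWeakCorrector L F w δ → (∀ X, g X = s * (w X + r X)) →
    hMinusOneSqW L F g ≤
      ENNReal.ofReal (2 * s ^ 2 * dirichletFormW L F δ δ) + ENNReal.ofReal (2 * s ^ 2) * hMinusOneSqW L F r

/-! ### Saturated non-measurable sets of configurations -/

/-- A set is *saturated* if every measurable subset of it AND of its complement is null. -/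
def IsSaturated {α : Type*} [MeasurableSpace α] (μ : Measure α) (S : Set α) : Prop :=
  (∀ B : Set α, MeasurableSet B → B ⊆ S → μ B = 0) ∧
    (∀ B : Set α, MeasurableSet B → B ⊆ Sᶜ → μ B = 0)

/-- Saturation transports along measure-preserving measurable equivalences. -/
theorem IsSaturated.preimage {α β : Type*} [MeasurableSpace α] [MeasurableSpace β]
    {μ : Measure α} {ν : Measure β} (e : α ≃ᵐ β) (he : MeasurePreserving e μ ν) {S : Set β}
    (hS : IsSaturated ν S) : IsSaturated μ (e ⁻¹' S) := by
  have key : ∀ (T : Set β), (∀ B, MeasurableSet B → B ⊆ T → ν B = 0) →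
      ∀ B, MeasurableSet B → B ⊆ e ⁻¹' T → μ B = 0 := by
    intro T hT B hB hBT
    have h1 : ν (e.symm ⁻¹' B) = 0 :=
      hT _ (e.symm.measurable hB) (fun y hy => by simpa using hBT hy)
    have h2 : B = e ⁻¹' (e.symm ⁻¹' B) := by ext x; simp
    rw [h2, he.measure_preimage_equiv]
    exact h1
  exact ⟨key S hS.1, by simpa using key Sᶜ hS.2⟩

/-- A product slab over a saturated set is saturated. -/
theorem IsSaturated.prod_univ {α β : Type*} [MeasurableSpace α] [MeasurableSpace β]
    {μ : Measure α} {ν : Measure β} [SFinite ν] [SFinite μ] {A : Set α} (hA : IsSaturated μ A) :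
    IsSaturated (μ.prod ν) (A ×ˢ Set.univ) := by
  have key : ∀ (T : Set α), (∀ B, MeasurableSet B → B ⊆ T → μ B = 0) →
      ∀ B : Set (α × β), MeasurableSet B → B ⊆ T ×ˢ Set.univ → μ.prod ν B = 0 := by
    intro T hT B hB hBT
    rw [Measure.prod_apply hB]
    refine Literature.MeasureTheory.Lebesgue.lintegral_eq_zero_of_innerNull hT ?_
    intro x hx
    have : Prod.mk x ⁻¹' B = ∅ := by
      ext y
      simp only [Set.mem_preimage, Set.mem_empty_iff_false, iff_false]
      intro hxy
      exact hx (hBT hxy).1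
    rw [this, measure_empty]
  refine ⟨key A hA.1, ?_⟩
  have hc : (A ×ˢ (Set.univ : Set β))ᶜ = Aᶜ ×ˢ Set.univ := by
    ext p; simp
  rw [hc]
  exact key Aᶜ hA.2

/-- A saturated set of one-particle configurations (`Config 1 ≃ ℝ³`). -/
theorem exists_isSaturated_config_one : ∃ S : Set (Config 1), IsSaturated volume S := by
  obtain ⟨A, hA, hAc⟩ := Literature.MeasureTheory.Lebesgue.exists_saturated_euclideanSpace 2
  exact ⟨_, IsSaturated.preimage (MeasurableEquiv.funUnique (Fin 1) Space)
    (volume_preserving_funUnique (Fin 1) Space) ⟨hA, hAc⟩⟩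

/-- A saturated set of two-particle configurations (`Config 2 ≃ ℝ³ × ℝ³`). -/
theorem exists_isSaturated_config_two : ∃ S : Set (Config 2), IsSaturated volume S := by
  obtain ⟨A, hA, hAc⟩ := Literature.MeasureTheory.Lebesgue.exists_saturated_euclideanSpace 2
  have h1 : IsSaturated ((volume : Measure Space).prod (volume : Measure Space)) (A ×ˢ Set.univ) :=
    IsSaturated.prod_univ ⟨hA, hAc⟩
  refine ⟨_, IsSaturated.preimage (MeasurableEquiv.piFinTwo fun _ : Fin 2 => Space) ?_ h1⟩
  simpa [Measure.volume_eq_prod] using volume_preserving_piFinTwo fun _ : Fin 2 => Space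

/-! ### Bochner integrals against the indicator of a saturated set vanish -/

/-- If `1_S · f` is integrable on the cell for a saturated `S` and a continuous `f`, then `f` vanishes
a.e. on the cell. -/
theorem ae_eq_zero_of_integrable_indicator_mul {N : ℕ} {L : ℝ} {S : Set (Config N)}
    (hS : IsSaturated volume S) {f : Config N → ℝ} (hf : Continuous f)
    (hint : Integrable (fun X => S.indicator (fun _ => (1 : ℝ)) X * f X) (volume.restrict (cellN N L))) :
    f =ᵐ[volume.restrict (cellN N L)] 0 := by
  set μ := volume.restrict (cellN N L) with hμ
  -- a measurable version `g'` of `1_S f`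
  obtain ⟨g', hg'm, hgg'⟩ := hint.aestronglyMeasurable
  have hg'meas : Measurable g' := hg'm.measurable
  -- `{g' ≠ 0}` is, up to a null set, a measurable subset of `S`: so it is null
  have hU : μ {X | g' X ≠ 0} = 0 := by
    -- the set where `1_S f = g'`
    have hae : ∀ᵐ X ∂μ, S.indicator (fun _ => (1 : ℝ)) X * f X = g' X := hgg'
    rw [hμ, ae_restrict_iff' (measurableSet_cellN N L)] at hae
    obtain ⟨T, hTm, hT0, hTsub⟩ : ∃ T : Set (Config N), MeasurableSet T ∧ volume T = 0 ∧
        {X | ¬ (X ∈ cellN N L → S.indicator (fun _ => (1 : ℝ)) X * f X = g' X)} ⊆ T := by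
      exact ⟨toMeasurable volume _, measurableSet_toMeasurable _ _,
        by rw [measure_toMeasurable]; exact hae, subset_toMeasurable _ _⟩
    have hsub : ({X | g' X ≠ 0} ∩ cellN N L) \ T ⊆ S := by
      intro X hX
      obtain ⟨⟨hX1, hX2⟩, hX3⟩ := hX
      by_contra hXS
      have h4 : S.indicator (fun _ => (1 : ℝ)) X * f X = g' X := by
        by_contra h5
        exact hX3 (hTsub (fun h6 => h5 (h6 hX2)))
      rw [Set.indicator_of_notMem hXS, zero_mul] at h4
      exact hX1 (h4.symm)
    have hmeas : MeasurableSet (({X | g' X ≠ 0} ∩ cellN N L) \ T) :=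
      ((hg'meas (measurableSet_singleton 0).compl).inter (measurableSet_cellN N L)).diff hTm
    have h0 := hS.1 _ hmeas hsub
    rw [hμ, Measure.restrict_apply' (measurableSet_cellN N L)]
    refine measure_mono_null (fun X hX => ?_) (measure_union_null h0 hT0)
    by_cases hXT : X ∈ T
    · exact Or.inr hXT
    · exact Or.inl ⟨hX, hXT⟩
  -- hence `1_S f = 0` a.e., i.e. `f = 0` a.e. on `S`; co-saturation then gives `f = 0` a.e.
  have h1 : ∀ᵐ X ∂μ, S.indicator (fun _ => (1 : ℝ)) X * f X = 0 := by
    filter_upwards [hgg', (measure_eq_zero_iff_ae_notMem.1 hU)] with X h1 h2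
    rw [h1]
    simpa using h2
  rw [hμ, ae_restrict_iff' (measurableSet_cellN N L)] at h1
  obtain ⟨T, hTm, hT0, hTsub⟩ : ∃ T : Set (Config N), MeasurableSet T ∧ volume T = 0 ∧
      {X | ¬ (X ∈ cellN N L → S.indicator (fun _ => (1 : ℝ)) X * f X = 0)} ⊆ T :=
    ⟨toMeasurable volume _, measurableSet_toMeasurable _ _,
      by rw [measure_toMeasurable]; exact h1, subset_toMeasurable _ _⟩
  have hsub2 : ({X | f X ≠ 0} ∩ cellN N L) \ T ⊆ Sᶜ := by
    intro X hX hXS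
    obtain ⟨⟨hX1, hX2⟩, hX3⟩ := hX
    have h4 : S.indicator (fun _ => (1 : ℝ)) X * f X = 0 := by
      by_contra h5
      exact hX3 (hTsub (fun h6 => h5 (h6 hX2)))
    rw [Set.indicator_of_mem hXS, one_mul] at h4
    exact hX1 h4
  have hmeas2 : MeasurableSet (({X | f X ≠ 0} ∩ cellN N L) \ T) :=
    ((hf.measurable (measurableSet_singleton 0).compl).inter (measurableSet_cellN N L)).diff hTm
  have h02 := hS.2 _ hmeas2 hsub2
  rw [Filter.EventuallyEq, hμ, ae_restrict_iff' (measurableSet_cellN N L)]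
  rw [ae_iff]
  refine measure_mono_null (fun X hX => ?_) (measure_union_null h02 hT0)
  simp only [Set.mem_setOf_eq, Classical.not_imp, Pi.zero_apply] at hX
  by_cases hXT : X ∈ T
  · exact Or.inr hXT
  · exact Or.inl ⟨⟨hX.2, hX.1⟩, hXT⟩

/-- **The charge `1_S` is invisible to Bochner pairings**: `∫_cell 1_S f = 0` for continuous `f`. -/
theorem integral_indicator_mul_eq_zero {N : ℕ} {L : ℝ} {S : Set (Config N)}
    (hS : IsSaturated volume S) {f : Config N → ℝ} (hf : Continuous f) :
    ∫ X in cellN N L, S.indicator (fun _ => (1 : ℝ)) X * f X = 0 := by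
  by_cases hint : Integrable (fun X => S.indicator (fun _ => (1 : ℝ)) X * f X)
      (volume.restrict (cellN N L))
  · have hae := ae_eq_zero_of_integrable_indicator_mul hS hf hint
    refine integral_eq_zero_of_ae ?_
    filter_upwards [hae] with X hX
    simp [hX]
  · exact integral_undef hint

/-- Same for the complementary charge `h - 1_S` with `h` continuous. -/
theorem integral_sub_indicator_mul_eq_zero {N : ℕ} {L : ℝ} {S : Set (Config N)}
    (hS : IsSaturated volume S) {h f : Config N → ℝ} (hh : Continuous h) (hf : Continuous f) :
    ∫ X in cellN N L, (h X - S.indicator (fun _ => (1 : ℝ)) X) * f X = 0 := by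
  by_cases hint : Integrable (fun X => S.indicator (fun _ => (1 : ℝ)) X * f X)
      (volume.restrict (cellN N L))
  · have hae := ae_eq_zero_of_integrable_indicator_mul hS hf hint
    refine integral_eq_zero_of_ae ?_
    filter_upwards [hae] with X hX
    simp [hX]
  · apply integral_undef
    intro hint2
    apply hint
    have h3 : Integrable (fun X => h X * f X) (volume.restrict (cellN N L)) :=
      integrableOn_cellN (hh.mul hf) L
    have := h3.sub hint2
    refine this.congr (Filter.Eventually.of_forall fun X => ?_)
    simp only [Pi.sub_apply]
    ring

/-! ### The refutations -/

/-- A periodic test function with `∫ φ² F² > 0` has positive `H₋₁` norm as an observable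
(test against `s φ` with `s = I/(D+1)`). -/
theorem hMinusOneSqW_pos_of_sq_integral_pos {N : ℕ} {L : ℝ} {F φ : Config N → ℝ}
    (hφ : IsPeriodicTest L φ) (hI : 0 < ∫ X in cellN N L, φ X * φ X * F X ^ 2) :
    0 < hMinusOneSqW L F φ := by
  set I := ∫ X in cellN N L, φ X * φ X * F X ^ 2 with hIdef
  set D := dirichletFormW L F φ φ with hD
  have hD0 : 0 ≤ D := dirichletFormW_self_nonneg L F φ
  set s := I / (D + 1) with hs
  have hspos : 0 < s := by positivity
  have hle := le_hMinusOneSqW L F φ (hφ.smul s)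
  rw [integral_mul_smul_mul_sq, dirichletFormW_smul_left, dirichletFormW_smul_right, ← hIdef,
    ← hD] at hle
  refine lt_of_lt_of_le ?_ hle
  rw [ENNReal.ofReal_pos]
  have h1 : s * D < I := by
    rw [hs, div_mul_eq_mul_div, div_lt_iff₀ (by positivity)]
    nlinarith
  nlinarith

/-- The smooth periodic charge `h(X) = cos θ_{e₀}(x₁)` on `Config (n+1)`. -/
def cosCharge (n : ℕ) (L : ℝ) (X : Config (n + 1)) : ℝ :=
  Real.cos (arg L e0 (X 0))

theorem continuous_cosCharge (n : ℕ) (L : ℝ) : Continuous (cosCharge n L) := by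
  unfold cosCharge; fun_prop

theorem isPeriodicTest_cosCharge (n : ℕ) {L : ℝ} (hL : L ≠ 0) : IsPeriodicTest L (cosCharge n L) := by
  refine ⟨?_, fun X i a => ?_⟩
  · unfold cosCharge
    exact (Real.contDiff_cos.comp (contDiff_arg L e0)).comp (contDiff_apply ℝ Space 0)
  · unfold cosCharge
    rw [Pi.add_apply]
    by_cases hi : (0 : Fin (n + 1)) = i
    · subst hi
      rw [Pi.single_eq_same, arg_add_single hL, show arg L e0 (X 0) + 2 * Real.pi * (e0 a : ℝ) =
        arg L e0 (X 0) + ((e0 a : ℤ) : ℝ) * (2 * Real.pi) by ring, Real.cos_add_int_mul_two_pi]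
    · rw [Pi.single_eq_of_ne hi, add_zero]

/-- `∫_{cell¹} h² = L³/2` on the unit-weight torus. -/
theorem integral_cosCharge_sq_one {L : ℝ} (hL : 0 < L) :
    ∫ X in cellN 1 L, cosCharge 0 L X * cosCharge 0 L X * (fun _ : Config 1 => (1 : ℝ)) X ^ 2 =
      L ^ 3 / 2 := by
  have h1 : (fun X : Config 1 => cosCharge 0 L X * cosCharge 0 L X * (fun _ : Config 1 => (1 : ℝ)) X ^ 2)
      = fun X => (fun x => Real.cos (arg L e0 x) ^ 2) (X 0) := by
    funext X; simp only [cosCharge]; ring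
  rw [h1, integral_cellN_one L (fun x => Real.cos (arg L e0 x) ^ 2)]
  have h2 : (fun x => Real.cos (arg L e0 x) ^ 2) = fun x => (1 / 2 + 0 * Real.cos (arg L e0 x)
      + 1 / 2 * Real.cos (arg L ((2 : ℤ) • e0) x) + 0 * Real.cos (arg L ((3 : ℤ) • e0) x)) := by
    funext x
    rw [arg_intSMul, show ((2 : ℤ) : ℝ) * arg L e0 x = 2 * arg L e0 x by push_cast; ring,
      Real.cos_sq]
    ring
  rw [h2, integral_cell_trig_combo hL e0_ne_zero]
  ring

/-- `∫_{cell²} h² = L⁶/2`. -/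
theorem integral_cosCharge_sq_two {L : ℝ} (hL : 0 < L) :
    ∫ X in cellN 2 L, cosCharge 1 L X * cosCharge 1 L X * (fun _ : Config 2 => (1 : ℝ)) X ^ 2 =
      L ^ 3 / 2 * L ^ 3 := by
  have h1 : (fun X : Config 2 => cosCharge 1 L X * cosCharge 1 L X * (fun _ : Config 2 => (1 : ℝ)) X ^ 2)
      = fun X => (fun x => Real.cos (arg L e0 x) ^ 2) (X 0) * (fun _ : Space => (1 : ℝ)) (X 1) := by
    funext X; simp only [cosCharge]; ring
  rw [h1, integral_cellN_two_mul (fun x => Real.cos (arg L e0 x) ^ 2) (fun _ => (1 : ℝ))]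
  have h2 : (fun x => Real.cos (arg L e0 x) ^ 2) = fun x => (1 / 2 + 0 * Real.cos (arg L e0 x)
      + 1 / 2 * Real.cos (arg L ((2 : ℤ) • e0) x) + 0 * Real.cos (arg L ((3 : ℤ) • e0) x)) := by
    funext x
    rw [arg_intSMul, show ((2 : ℤ) : ℝ) * arg L e0 x = 2 * arg L e0 x by push_cast; ring,
      Real.cos_sq]
    ring
  rw [h2, integral_cell_trig_combo hL e0_ne_zero, integral_cell_const hL]
  ring

/-- **`FibreSubadditivity` is false as typed.**  Witness: `N = 2`, `L = 1`, `F ≡ 1`, charges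
`θ₀ = 1_S`, `θ₁ = h − 1_S` with `S ⊆ Config 2` saturated non-measurable and `h = cos θ_{e₀}(x₁)`,
constants `c ≡ 0`: every Bochner pairing `∫ θᵢ φ F²` vanishes (junk or genuinely), so the fibre
bounds hold with `cᵢ = 0`, while `∑ θᵢ = h` has `‖h‖²₋₁ > 0`.  REPAIR: assume the charges
continuous (or periodic tests), e.g. add `(∀ i, Continuous (θ i))`; the card's intended use
(conditionally centred smooth one-particle charges) is unaffected. -/
theorem not_fibreSubadditivity : ¬ FibreSubadditivity := by
  intro h
  obtain ⟨S, hS⟩ := exists_isSaturated_config_two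
  set F : Config 2 → ℝ := fun _ => 1 with hF
  set hc : Config 2 → ℝ := cosCharge 1 1 with hhc
  set θ : Fin 2 → Config 2 → ℝ := ![S.indicator fun _ => (1 : ℝ), fun X => hc X - S.indicator (fun _ => (1 : ℝ)) X]
    with hθ
  have key := h 2 1 F θ (fun _ => 0) one_pos continuous_const (fun _ => le_rfl) ?_
  · -- the conclusion says `‖h‖²₋₁ ≤ 0`
    have hsum : (fun X => ∑ i, θ i X) = hc := by
      funext X
      simp [hθ, Fin.sum_univ_two]
    rw [hsum] at key
    simp only [Finset.sum_const_zero, ENNReal.ofReal_zero, nonpos_iff_eq_zero] at key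
    have hpos : 0 < hMinusOneSqW 1 F hc :=
      hMinusOneSqW_pos_of_sq_integral_pos (isPeriodicTest_cosCharge 1 one_ne_zero)
        (by rw [hhc, hF, integral_cosCharge_sq_two one_pos]; norm_num)
    exact hpos.ne' key
  · -- the fibre bounds hold with `cᵢ = 0`: all pairings vanish
    intro i φ hφ
    have hcont : Continuous fun X => φ X * F X ^ 2 := by
      have := hφ.continuous; rw [hF]; fun_prop
    have hint : ∫ X in cellN 2 1, θ i X * φ X * F X ^ 2 = 0 := by
      fin_cases i
      · have : (fun X => θ 0 X * φ X * F X ^ 2) =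
            fun X => S.indicator (fun _ => (1 : ℝ)) X * (φ X * F X ^ 2) := by
          funext X; simp [hθ]; ring
        simp only [Fin.zero_eta] at this ⊢
        rw [this]
        exact integral_indicator_mul_eq_zero hS hcont
      · have : (fun X => θ 1 X * φ X * F X ^ 2) =
            fun X => (hc X - S.indicator (fun _ => (1 : ℝ)) X) * (φ X * F X ^ 2) := by
          funext X; simp [hθ]; ring
        simp only [Fin.mk_one] at this ⊢
        rw [this]
        exact integral_sub_indicator_mul_eq_zero hS (continuous_cosCharge 1 1) hcont
    rw [hint]
    simp

/-- **`ScreenedFluxBound` is false as typed.**  Witness: `N = 1`, `L = 1`, `F ≡ 1`, `δ ≡ 0`,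
`w = 1_S` (`S ⊆ Config 1` saturated), `r = h − 1_S`, `g = h`, `s = 1`: `w` is a weak corrector of
`δ ≡ 0` by Bochner junk (`∫ 1_S φ = 0` for every test `φ`), `‖r‖²₋₁ = 0` likewise, yet
`‖g‖²₋₁ = ‖h‖²₋₁ > 0`.  REPAIR: require `Continuous w` and `Continuous r` (or `g, w, r` periodic
tests / in `L²(F²dX)`); the card's intended use (smooth density wave, drift wave, Feynman defect)
is unaffected. -/
theorem not_screenedFluxBound : ¬ ScreenedFluxBound := by
  intro h
  obtain ⟨S, hS⟩ := exists_isSaturated_config_one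
  set F : Config 1 → ℝ := fun _ => 1 with hF
  set hc : Config 1 → ℝ := cosCharge 0 1 with hhc
  set w : Config 1 → ℝ := S.indicator fun _ => (1 : ℝ) with hw
  set r : Config 1 → ℝ := fun X => hc X - S.indicator (fun _ => (1 : ℝ)) X with hr
  have hcorr : IsWeakCorrector 1 F w (fun _ => 0) := by
    refine ⟨IsPeriodicTest.const 1 0, fun φ hφ => ?_⟩
    rw [dirichletFormW_const_left]
    have hcont : Continuous fun X => φ X * F X ^ 2 := by
      have := hφ.continuous; rw [hF]; fun_prop
    have : (fun X => w X * φ X * F X ^ 2) = fun X => S.indicator (fun _ => (1 : ℝ)) X * (φ X * F X ^ 2) := by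
      funext X; rw [hw]; ring
    rw [this, integral_indicator_mul_eq_zero hS hcont]
  have key := h 1 1 F hc w r (fun _ => 0) 1 one_pos continuous_const hcorr
    (fun X => by rw [hw, hr]; ring)
  -- `‖r‖²₋₁ = 0`
  have hr0 : hMinusOneSqW 1 F r = 0 := by
    refine le_antisymm ?_ bot_le
    unfold hMinusOneSqW
    refine iSup₂_le fun φ hφ => ?_
    have hcont : Continuous fun X => φ X * F X ^ 2 := by
      have := hφ.continuous; rw [hF]; fun_prop
    have : (fun X => r X * φ X * F X ^ 2) =
        fun X => (hc X - S.indicator (fun _ => (1 : ℝ)) X) * (φ X * F X ^ 2) := by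
      funext X; rw [hr]; ring
    rw [this, integral_sub_indicator_mul_eq_zero hS (continuous_cosCharge 0 1) hcont, mul_zero,
      zero_sub, ENNReal.ofReal_of_nonpos (neg_nonpos.2 (dirichletFormW_self_nonneg _ _ _))]
  rw [hr0, mul_zero, add_zero, dirichletFormW_const_left, mul_zero, ENNReal.ofReal_zero,
    nonpos_iff_eq_zero] at key
  have hpos : 0 < hMinusOneSqW 1 F hc :=
    hMinusOneSqW_pos_of_sq_integral_pos (isPeriodicTest_cosCharge 0 one_ne_zero)
      (by rw [hhc, hF, integral_cosCharge_sq_one one_pos]; norm_num)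
  exact hpos.ne' key

end

end Summit.AtomisticToContinuum.BoseEinsteinCondensation.Cruxes.StaticResponseBound.Disproof
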